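import Mathlib
import Literature.NumberTheory.MahlerMeasure.IntegerMahlerMeasure
import Literature.NumberTheory.MahlerMeasure.MinimalMeasuresByDegree
import Literature.NumberTheory.MahlerMeasure.AbelianHeightBound
import HarnessLib

/-!
# The Amoroso–Dvornicich height bound for cyclotomic integers `h(α) ≥ log(5/2)/10` (Bombieri–Gubler Thm 4.4.9, integral case): Lehmer's problem for cyclotomic integers — `CyclotomicIntegerHeightBound` HOLDS (re-homed proofs)

**The Amoroso–Dvornicich lower bound for the height of cyclotomic integers** (Bombieri–Gubler, *Heights in Diophantine
Geometry*, Theorem 4.4.9, integral case; F. Amoroso, R. Dvornicich, J. Number Theory 80 (2000)): for every `m ≥ 1`, every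
primitive `m`-th root of unity `ζ ∈ ℂ` and every algebraic integer `α ∈ ℚ(ζ)` which is neither `0` nor a root of unity,
`h(α) ≥ log(5/2)/10`, i.e. `(5/2)^{deg α} ≤ M(minpoly_ℤ α)^{10}` — in particular `M(α) > M(ℓ) = 1.17628…` (Lehmer's problem is
settled for cyclotomic integers) — RE-HOMED into `Literature/` by the Hodge foundations lane (`lit-hodgefound`, seat p20,
generation 36) from the venture cell `pub-namedobj` (seats `pub-namedobj-mahler-g2`, `-g26`, `-g27`, `-g28`): verbatim DECLARATION-LEVEL
ports, in dependency order and each with its original module docstring, of the modules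
`Summits/Ventures/DiscreteObjects/Mahler/{OddCoefficientsResultant (1 decl), LehmerLowerBound (2), LehmerExactMeasure (8),
DobrowolskiLemma (1), CyclotomicIntegerMeasure, SymmetricRootIntegrality, CyclotomicIntegerLehmer (3), CyclotomicIntegerRamified,
CyclotomicIntegerDescent, CyclotomicIntegerGaloisDescent, CyclotomicIntegerTwistFibre, CyclotomicIntegerLehmerAll (6),
CyclotomicFieldIntegersLehmer (2)}.lean`, namespace `Summit.Ventures.DiscreteObjects.Mahler` re-rooted as
`Literature.NumberTheory.MahlerMeasure` (this file's path namespace); the generic Mahler-measure lemmas are the base file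
`IntegerMahlerMeasure.lean`, and the cell's `lehmerPoly` is NOT re-declared: it is, verbatim, the tree's
`Literature.NumberTheory.MahlerMeasure.lehmerPolynomial` (`MinimalMeasuresByDegree.lean`), which this file REUSES.

PROOF AS FORMALISED (= the printed proof of [BombieriGubler2001, Thm 4.4.9] with `p = 5`, by strong induction on the
conductor; see the Part headers): Case I (`p ∤ m`): `g^p − g(X^p) = p·T` in `ℤ[X]`, the resultant `Res(Φ_m, g^p − g(X^p))` is a
nonzero multiple of `p^{φ(m)}` and has modulus `≤ 2^{φ(m)} H^{p+1}`, `H = ∏_μ max(1,|g(μ)|) = M(α)^{φ(m)/deg α}` (symmetric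
functions of roots are integers; `∏_μ (X − g(μ)) = (minpoly α)^e`); Case II (`m = 5n`): either `α^5` is moved by a generator
of `Gal(ℚ(ζ_m)/ℚ(ζ_n))` (ramified resultant bound) or a root-of-unity twist of `α` descends EXPLICITLY to `ℤ[ζ_m^5]` (trace
formulas) and the induction hypothesis applies; finally the presentation `α = g(ζ)` is removed by Mathlib's
`𝒪_{ℚ(ζ_m)} = ℤ[ζ_m]`, and `M(α) > M(ℓ)` uses the kernel enclosure `1.176280818259 < M(ℓ) < 1.176280818260` of Lehmer's measure
(Part LehmerExactMeasure: `ℓ = x⁵Q(x + 1/x)`, five real roots of the trace quintic, `M(ℓ)` = the largest root).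
Theorems only (no definition, no named fact); imports Mathlib/Literature only; every declaration carries the citation of the
printed step it formalises.  The last Part is the EXACT discharge
`Literature.NumberTheory.MahlerMeasure.CyclotomicIntegerHeightBound_holds` of the Literature named fact `CyclotomicIntegerHeightBound`
(`AbelianHeightBound.lean`); its only previous proof was the Summits-side `Summit.Ventures.DiscreteObjects.Mahler.cyclotomicIntegerHeightBound_holds`,
which `Literature/` cannot import.  The Summits originals stay in place (transitional duplication; twins = same short names in
`Summit.Ventures.DiscreteObjects.Mahler`).  The general (non-integral `α`, arbitrary abelian `K/ℚ` via Kronecker–Weber) statement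
of Theorem 4.4.9 is NOT here (see the TODO in `AbelianHeightBound.lean`).
-/

noncomputable section

/-!
## Part 1 — port of `Summits/Ventures/DiscreteObjects/Mahler/OddCoefficientsResultant.lean` (1 declarations kept)

# Resultants of an odd-coefficient polynomial with `X^n ∓ 1`, `X^{2n} + 1` (venture `DiscreteObjects`, target L)

Cell `pub-namedobj`, seat `pub-namedobj-mahler` (gen 8). Framing: lottery ticket; floor = certified
bounds/negative ranges.

This is Lemma 3.1 (case `m = 2`) of Borwein–Dobrowolski–Mossinghoff, *Lehmer's problem for polynomials
with odd coefficients*, Ann. of Math. 166 (2007) 347–366, in Mathlib's vocabulary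
(`Polynomial.resultant`, explicit Sylvester formats `(deg f, N)`):

* `exists_X_pow_sub_one_eq_of_odd` — if all coefficients `f_0, …, f_d` of `f ∈ ℤ[X]` are odd then
  `X^{d+1} - 1 = 2 s + f · (X - 1)` for some `s ∈ ℤ[X]` with `deg s ≤ d + 1` ((3.3) of the paper);
* `two_pow_le_abs_resultant` — if `G = 2 T + f · P` with `deg P + deg f ≤ N` and `Res(f, G) ≠ 0` then
  `2^{deg f} ≤ |Res(f, G)|`; applied to `G = X^{d+1} - 1`, `X^{d+1} + 1`, `X^{2(d+1)} + 1`
  (`two_pow_le_abs_resultant_X_pow_sub_one` / `_add_one` / `_X_pow_two_mul_add_one`);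
* `resultant_intCast_eq` — over `ℂ`, `Res(f, G) = a^N ∏_{f(α)=0} G(α)` (Mathlib's
  `resultant_eq_prod_eval`), and `pow_ne_one_of_cyclotomicFree` — the roots of a cyclotomic-free
  integer polynomial are not roots of unity, so these resultants are nonzero
  (`resultant_ne_zero_of_cyclotomicFree`).

These feed the proof of [BDM07, Cor. 3.4] in `OddCoefficientsMahlerBound`.
-/

section Part1

namespace Literature.NumberTheory.MahlerMeasure

open _root_.Polynomial

/-- **Resultant over `ℂ`.** For `f, G ∈ ℤ[X]` with `deg G ≤ N`, the integer `Res_{(deg f, N)}(f, G)`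
equals `a^N ∏_{f(α) = 0} G(α)` over the complex roots of `f` (with multiplicity), `a` the leading
coefficient (Mathlib's `resultant_eq_prod_eval` after base change).
[cite: BombieriGubler2001, Theorem 4.4.9 p.116 (proof: resultant step)] -/
theorem resultant_intCast_eq {f G : ℤ[X]} {N : ℕ} (hG : G.natDegree ≤ N) :
    ((f.resultant G f.natDegree N : ℤ) : ℂ) =
      (f.map (Int.castRingHom ℂ)).leadingCoeff ^ N *
        ((f.map (Int.castRingHom ℂ)).roots.map (G.map (Int.castRingHom ℂ)).eval).prod := by
  have hinj : Function.Injective (Int.castRingHom ℂ) := (Int.castRingHom ℂ).injective_int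
  have hdeg : (f.map (Int.castRingHom ℂ)).natDegree = f.natDegree :=
    natDegree_map_eq_of_injective hinj f
  rw [← eq_intCast (Int.castRingHom ℂ), ← resultant_map_map, ← hdeg]
  exact resultant_eq_prod_eval _ _ N (natDegree_map_le.trans hG) (IsAlgClosed.splits _)

end Literature.NumberTheory.MahlerMeasure

end Part1

/-!
## Part 2 — port of `Summits/Ventures/DiscreteObjects/Mahler/LehmerLowerBound.lean` (2 declarations kept)

# A kernel-checked lower bound for the Mahler measure of Lehmer's polynomial

Cell `pub-namedobj`, target (L). Framing: lottery ticket; floor = certified bounds/negative ranges.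

We prove `117628 / 100000 < M(L)` for Lehmer's polynomial `L = x¹⁰+x⁹-x⁷-x⁶-x⁵-x⁴-x³+x+1`
(`Literature.NumberTheory.MahlerMeasure.lehmerPolynomial`): `L(117628/100000) < 0 < L(117629/100000)`, so
by the intermediate value theorem `L` has a real root `α ∈ (1.17628, 1.17629)`; a root of a monic
polynomial is bounded by its Mahler measure (`M = ∏ max(1,|αᵢ|)`), hence `1.17628 < α ≤ M(L)`.
(The cell's certified value is `M(L) = 1.1762808182599175065440703384740350506934158…`, three
independent engines; the matching upper bound needs the location of the other nine roots and is
not proved here.)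
-/

section Part2

namespace Literature.NumberTheory.MahlerMeasure

open _root_.Polynomial

/-- Evaluation of Lehmer's polynomial in any commutative ring algebra.
[cite: MossinghoffRhinWu2008, p.452 (Lehmer's polynomial, M(ℓ) = 1.176280…)] -/
theorem aeval_lehmerPoly {R : Type*} [CommRing R] [Algebra ℤ R] (x : R) :
    aeval x lehmerPolynomial = x ^ 10 + x ^ 9 - x ^ 7 - x ^ 6 - x ^ 5 - x ^ 4 - x ^ 3 + x + 1 := by
  simp [lehmerPolynomial, map_add, map_sub]

/-- Lehmer's polynomial is monic. [cite: MossinghoffRhinWu2008, p.452 (Lehmer's polynomial, M(ℓ) = 1.176280…)] -/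
theorem lehmerPoly_monic : lehmerPolynomial.Monic := by
  unfold lehmerPolynomial
  monicity!

end Literature.NumberTheory.MahlerMeasure

end Part2

/-!
## Part 3 — port of `Summits/Ventures/DiscreteObjects/Mahler/LehmerExactMeasure.lean` (8 declarations kept)

# Lehmer's constant in the kernel: `M(L)` is the largest root and `1.176280818259 < M(L) < 1.176280818260`

Cell `pub-namedobj`, seat `pub-namedobj-mahler-g2`, target (L). Framing: lottery ticket; floor = certified
bounds/negative ranges.

`LehmerLowerBound.lean` proved `1.17628 < M(L)` for Lehmer's polynomial
`L = x¹⁰+x⁹-x⁷-x⁶-x⁵-x⁴-x³+x+1` and left the upper bound open ("needs the location of the other nine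
roots"). Here we locate all ten roots and COMPUTE `M(L)` exactly, kernel-checked:

* `L(x) = x⁵·Q(x + 1/x)` with the trace polynomial `Q(y) = y⁵+y⁴-5y³-5y²+4y+3`;
* `Q` has five real roots `y₁ < y₂ < y₃ < y₄ < 2 < y₅` (intermediate value theorem on rational brackets),
  hence `Q = ∏ (y - yᵢ)` and `L = ∏ᵢ (x² - yᵢx + 1)` over `ℂ`;
* `M(x² - yx + 1) = 1` for `|y| < 2` (both roots on the unit circle) and `= (y + √(y²-4))/2` for `y > 2`;
* so `M(L) = (y₅ + √(y₅²-4))/2`, the root `α > 1` of `L` (`lehmer_measure_eq_largest_root`), and from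
  `Q(c + 1/c) < 0 < Q(c' + 1/c')` with `c = 1.176280818259`, `c' = 1.176280818260`:
  `c < M(L) < c'` (`lehmer_measure_enclosure`), in particular `M(L) < 1.17629`
  (`lehmer_measure_upper_bound`).

This is the cell's control C+L1 (Lehmer's measure `1.1762808182599175…`, three numerical engines) reproduced
inside the Lean kernel to 12 digits.
-/

section Part3

namespace Literature.NumberTheory.MahlerMeasure

open _root_.Polynomial

/-! ## Quadratic reciprocal factors -/

/-- For `-2 < y < 2` the polynomial `x² - yx + 1` has both roots on the unit circle: `M = 1`.
[cite: MossinghoffRhinWu2008, p.452 (M(ℓ) = 1.176280…)] -/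
theorem mahlerMeasure_quad_of_abs_lt_two {y : ℝ} (h1 : -2 < y) (h2 : y < 2) :
    (X ^ 2 - C (y : ℂ) * X + 1 : ℂ[X]).mahlerMeasure = 1 := by
  have hpos : 0 ≤ 4 - y ^ 2 := by nlinarith
  set s : ℝ := Real.sqrt (4 - y ^ 2) with hs
  have hs2 : s ^ 2 = 4 - y ^ 2 := by rw [hs]; exact Real.sq_sqrt hpos
  set z₁ : ℂ := ((y : ℂ) + (s : ℂ) * Complex.I) / 2 with hz₁
  set z₂ : ℂ := ((y : ℂ) - (s : ℂ) * Complex.I) / 2 with hz₂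
  have hs2c : (s : ℂ) ^ 2 = 4 - (y : ℂ) ^ 2 := by exact_mod_cast hs2
  have hsum : z₁ + z₂ = (y : ℂ) := by rw [hz₁, hz₂]; ring
  have hprod : z₁ * z₂ = 1 := by
    rw [hz₁, hz₂]
    have hI : Complex.I ^ 2 = -1 := Complex.I_sq
    linear_combination (1 / 4 : ℂ) * hs2c - ((s : ℂ) ^ 2 / 4) * hI
  have hfac : (X ^ 2 - C (y : ℂ) * X + 1 : ℂ[X]) = (X - C z₁) * (X - C z₂) := by
    have : (X - C z₁) * (X - C z₂) = X ^ 2 - C (z₁ + z₂) * X + C (z₁ * z₂) := by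
      rw [map_add, map_mul]; ring
    rw [this, hsum, hprod, map_one]
  have hconj : (starRingEnd ℂ) z₁ = z₂ := by
    rw [hz₁, hz₂]
    simp [map_div₀, Complex.conj_ofReal, map_ofNat, sub_eq_add_neg]
  have hn1 : ‖z₁‖ = 1 := by
    have h := Complex.mul_conj z₁
    rw [hconj, hprod] at h
    -- h : 1 = ↑(Complex.normSq z₁)
    have hsq : Complex.normSq z₁ = 1 := by exact_mod_cast h.symm
    have : ‖z₁‖ ^ 2 = 1 := by rw [← Complex.normSq_eq_norm_sq]; exact hsq
    nlinarith [norm_nonneg z₁]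
  have hn2 : ‖z₂‖ = 1 := by rw [← hconj, Complex.norm_conj]; exact hn1
  rw [hfac, mahlerMeasure_mul, mahlerMeasure_X_sub_C, mahlerMeasure_X_sub_C, hn1, hn2]
  simp

/-- For `y > 2` the polynomial `x² - yx + 1` has the real roots `(y ± √(y²-4))/2`, product `1`:
`M = (y + √(y²-4))/2`. [cite: MossinghoffRhinWu2008, p.452 (M(ℓ) = 1.176280…)] -/
theorem mahlerMeasure_quad_of_two_lt {y : ℝ} (h : 2 < y) :
    (X ^ 2 - C (y : ℂ) * X + 1 : ℂ[X]).mahlerMeasure = (y + Real.sqrt (y ^ 2 - 4)) / 2 := by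
  have hpos : 0 ≤ y ^ 2 - 4 := by nlinarith
  set t : ℝ := Real.sqrt (y ^ 2 - 4) with ht
  have ht2 : t ^ 2 = y ^ 2 - 4 := by rw [ht]; exact Real.sq_sqrt hpos
  have ht0 : 0 ≤ t := Real.sqrt_nonneg _
  have hty : t < y := by nlinarith
  set r₁ : ℝ := (y + t) / 2 with hr₁
  set r₂ : ℝ := (y - t) / 2 with hr₂
  have hsum : r₁ + r₂ = y := by rw [hr₁, hr₂]; ring
  have hprod : r₁ * r₂ = 1 := by rw [hr₁, hr₂]; nlinarith
  have hr1 : 1 ≤ r₁ := by rw [hr₁]; linarith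
  have hr2pos : 0 < r₂ := by rw [hr₂]; linarith
  have hr2le : r₂ ≤ 1 := by nlinarith
  have hfac : (X ^ 2 - C (y : ℂ) * X + 1 : ℂ[X]) = (X - C (r₁ : ℂ)) * (X - C (r₂ : ℂ)) := by
    have : (X - C (r₁ : ℂ)) * (X - C (r₂ : ℂ)) = X ^ 2 - C ((r₁ : ℂ) + r₂) * X + C ((r₁ : ℂ) * r₂) := by
      rw [map_add, map_mul]; ring
    rw [this]
    have h1 : (r₁ : ℂ) + r₂ = (y : ℂ) := by exact_mod_cast hsum
    have h2 : (r₁ : ℂ) * r₂ = 1 := by exact_mod_cast hprod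
    rw [h1, h2, map_one]
  rw [hfac, mahlerMeasure_mul, mahlerMeasure_X_sub_C, mahlerMeasure_X_sub_C, Complex.norm_real,
    Complex.norm_real, Real.norm_of_nonneg (by linarith), Real.norm_of_nonneg hr2pos.le,
    max_eq_right hr1, max_eq_left hr2le, mul_one]

/-- Monotonicity of `r ↦ r + 1/r` on `[1, ∞)`, in the form used for the enclosures.
[cite: MossinghoffRhinWu2008, p.452 (M(ℓ) = 1.176280…)] -/
theorem lt_of_add_inv_lt_add_inv {r c : ℝ} (hc : 1 ≤ c) (hr : 0 < r) (h : r + r⁻¹ < c + c⁻¹) : r < c := by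
  by_contra hle
  rw [not_lt] at hle
  have hc0 : 0 < c := by linarith
  have key : (r + r⁻¹) - (c + c⁻¹) = (r - c) * (r * c - 1) / (r * c) := by
    field_simp
    ring
  have hnum : 0 ≤ (r - c) * (r * c - 1) := by
    apply mul_nonneg
    · linarith
    · nlinarith
  have : 0 ≤ (r + r⁻¹) - (c + c⁻¹) := by rw [key]; positivity
  linarith

/-! ## The trace polynomial `Q(y) = y⁵+y⁴-5y³-5y²+4y+3` -/

/-- `L(x) = x⁵·Q(x + 1/x)` for `x ≠ 0`. [cite: MossinghoffRhinWu2008, p.452 (M(ℓ) = 1.176280…)] -/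
theorem lehmer_eval_eq_trace {K : Type*} [Field K] (x : K) (hx : x ≠ 0) :
    x ^ 10 + x ^ 9 - x ^ 7 - x ^ 6 - x ^ 5 - x ^ 4 - x ^ 3 + x + 1 =
      x ^ 5 * ((x + x⁻¹) ^ 5 + (x + x⁻¹) ^ 4 - 5 * (x + x⁻¹) ^ 3 - 5 * (x + x⁻¹) ^ 2
        + 4 * (x + x⁻¹) + 3) := by
  field_simp
  ring

/-- The five real roots of the trace polynomial, with rational brackets (intermediate value theorem);
the bracket of the largest root is `(c + 1/c, c' + 1/c')` with `c = 1.176280818259`, `c' = 1.176280818260`.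
[cite: MossinghoffRhinWu2008, p.452 (M(ℓ) = 1.176280…)] -/
theorem lehmer_trace_roots :
    ∃ y₁ y₂ y₃ y₄ y₅ : ℝ,
      (-2 < y₁ ∧ y₁ < -17 / 10) ∧ (-17 / 10 < y₂ ∧ y₂ < -1) ∧ (-1 < y₃ ∧ y₃ < 0) ∧ (0 < y₄ ∧ y₄ < 1) ∧
      ((1176280818259 / 10 ^ 12 : ℝ) + (1176280818259 / 10 ^ 12)⁻¹ < y₅ ∧
        y₅ < (1176280818260 / 10 ^ 12 : ℝ) + (1176280818260 / 10 ^ 12)⁻¹) ∧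
      ∀ y ∈ [y₁, y₂, y₃, y₄, y₅], y ^ 5 + y ^ 4 - 5 * y ^ 3 - 5 * y ^ 2 + 4 * y + 3 = 0 := by
  set f : ℝ → ℝ := fun y => y ^ 5 + y ^ 4 - 5 * y ^ 3 - 5 * y ^ 2 + 4 * y + 3 with hf
  have hcont : Continuous f := by
    rw [hf]; fun_prop
  have root : ∀ a b : ℝ, a ≤ b → (f a < 0 ∧ 0 < f b) ∨ (f b < 0 ∧ 0 < f a) →
      ∃ y, a < y ∧ y < b ∧ f y = 0 := by
    intro a b hab h
    rcases h with ⟨ha, hb⟩ | ⟨hb, ha⟩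
    · obtain ⟨y, hy, hfy⟩ := intermediate_value_Ioo hab hcont.continuousOn ⟨ha, hb⟩
      exact ⟨y, hy.1, hy.2, hfy⟩
    · obtain ⟨y, hy, hfy⟩ := intermediate_value_Ioo' hab hcont.continuousOn ⟨hb, ha⟩
      exact ⟨y, hy.1, hy.2, hfy⟩
  obtain ⟨y₁, h1a, h1b, h1f⟩ := root (-2) (-17 / 10) (by norm_num)
    (Or.inl ⟨by rw [hf]; norm_num, by rw [hf]; norm_num⟩)
  obtain ⟨y₂, h2a, h2b, h2f⟩ := root (-17 / 10) (-1) (by norm_num)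
    (Or.inr ⟨by rw [hf]; norm_num, by rw [hf]; norm_num⟩)
  obtain ⟨y₃, h3a, h3b, h3f⟩ := root (-1) 0 (by norm_num)
    (Or.inl ⟨by rw [hf]; norm_num, by rw [hf]; norm_num⟩)
  obtain ⟨y₄, h4a, h4b, h4f⟩ := root 0 1 (by norm_num)
    (Or.inr ⟨by rw [hf]; norm_num, by rw [hf]; norm_num⟩)
  obtain ⟨y₅, h5a, h5b, h5f⟩ := root ((1176280818259 / 10 ^ 12 : ℝ) + (1176280818259 / 10 ^ 12)⁻¹)
    ((1176280818260 / 10 ^ 12 : ℝ) + (1176280818260 / 10 ^ 12)⁻¹) (by norm_num)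
    (Or.inl ⟨by rw [hf]; norm_num, by rw [hf]; norm_num⟩)
  refine ⟨y₁, y₂, y₃, y₄, y₅, ⟨h1a, h1b⟩, ⟨h2a, h2b⟩, ⟨h3a, h3b⟩, ⟨h4a, h4b⟩, ⟨h5a, h5b⟩, ?_⟩
  intro y hy
  simp only [List.mem_cons, List.not_mem_nil, or_false] at hy
  rcases hy with rfl | rfl | rfl | rfl | rfl
  · exact h1f
  · exact h2f
  · exact h3f
  · exact h4f
  · exact h5f

/-! ## `M(L)` exactly -/

/-- **Lehmer's constant is the largest root.** `M(L) = (y₅ + √(y₅² - 4))/2` where `y₅` is the root of the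
trace polynomial in `(2.0264179491867, 2.0264179491870)`; equivalently `M(L)` is the unique root `α > 1`
of `L` (`α + 1/α = y₅`), the other nine roots being `1/α` and eight numbers of modulus `1`.
[cite: MossinghoffRhinWu2008, p.452 (M(ℓ) = 1.176280…)] -/
theorem lehmer_measure_eq_largest_root : ∃ y : ℝ,
    (1176280818259 / 10 ^ 12 : ℝ) + (1176280818259 / 10 ^ 12)⁻¹ < y ∧
    y < (1176280818260 / 10 ^ 12 : ℝ) + (1176280818260 / 10 ^ 12)⁻¹ ∧
    y ^ 5 + y ^ 4 - 5 * y ^ 3 - 5 * y ^ 2 + 4 * y + 3 = 0 ∧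
    intMahlerMeasure lehmerPolynomial = (y + Real.sqrt (y ^ 2 - 4)) / 2 := by
  obtain ⟨y₁, y₂, y₃, y₄, y₅, h1, h2, h3, h4, h5, hroots⟩ := lehmer_trace_roots
  have hc_lo : (2 : ℝ) < (1176280818259 / 10 ^ 12 : ℝ) + (1176280818259 / 10 ^ 12)⁻¹ := by norm_num
  have hy5 : 2 < y₅ := lt_trans hc_lo h5.1
  refine ⟨y₅, h5.1, h5.2, hroots y₅ (by simp), ?_⟩
  -- the roots as complex numbers, and the root equations over ℂ
  have hrootsC : ∀ y ∈ [y₁, y₂, y₃, y₄, y₅],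
      (y : ℂ) ^ 5 + (y : ℂ) ^ 4 - 5 * (y : ℂ) ^ 3 - 5 * (y : ℂ) ^ 2 + 4 * (y : ℂ) + 3 = 0 := by
    intro y hy
    exact_mod_cast hroots y hy
  obtain ⟨s, hs⟩ : ∃ s : Multiset ℂ, s = {(y₁ : ℂ), (y₂ : ℂ), (y₃ : ℂ), (y₄ : ℂ), (y₅ : ℂ)} := ⟨_, rfl⟩
  -- pairwise distinct
  have h12 : (y₁ : ℂ) ≠ y₂ := by exact_mod_cast ne_of_lt (by linarith [h1.2, h2.1] : y₁ < y₂)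
  have h13 : (y₁ : ℂ) ≠ y₃ := by exact_mod_cast ne_of_lt (by linarith [h1.2, h3.1] : y₁ < y₃)
  have h14 : (y₁ : ℂ) ≠ y₄ := by exact_mod_cast ne_of_lt (by linarith [h1.2, h4.1] : y₁ < y₄)
  have h15 : (y₁ : ℂ) ≠ y₅ := by exact_mod_cast ne_of_lt (by linarith [h1.2, hy5] : y₁ < y₅)
  have h23 : (y₂ : ℂ) ≠ y₃ := by exact_mod_cast ne_of_lt (by linarith [h2.2, h3.1] : y₂ < y₃)
  have h24 : (y₂ : ℂ) ≠ y₄ := by exact_mod_cast ne_of_lt (by linarith [h2.2, h4.1] : y₂ < y₄)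
  have h25 : (y₂ : ℂ) ≠ y₅ := by exact_mod_cast ne_of_lt (by linarith [h2.2, hy5] : y₂ < y₅)
  have h34 : (y₃ : ℂ) ≠ y₄ := by exact_mod_cast ne_of_lt (by linarith [h3.2, h4.1] : y₃ < y₄)
  have h35 : (y₃ : ℂ) ≠ y₅ := by exact_mod_cast ne_of_lt (by linarith [h3.2, hy5] : y₃ < y₅)
  have h45 : (y₄ : ℂ) ≠ y₅ := by exact_mod_cast ne_of_lt (by linarith [h4.2, hy5] : y₄ < y₅)
  have hs_card : Multiset.card s = 5 := by rw [hs]; simp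
  have hs_nodup : s.Nodup := by
    rw [hs]
    simp [Multiset.insert_eq_cons, h12, h13, h14, h15, h23, h24, h25, h34, h35, h45]
  -- the trace polynomial over ℂ
  have hQeval : ∀ t : ℂ, (X ^ 5 + X ^ 4 - 5 * X ^ 3 - 5 * X ^ 2 + 4 * X + 3 : ℂ[X]).eval t =
      t ^ 5 + t ^ 4 - 5 * t ^ 3 - 5 * t ^ 2 + 4 * t + 3 := by
    intro t; simp
  have hQmonic : (X ^ 5 + X ^ 4 - 5 * X ^ 3 - 5 * X ^ 2 + 4 * X + 3 : ℂ[X]).Monic := by monicity!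
  have hQdeg : (X ^ 5 + X ^ 4 - 5 * X ^ 3 - 5 * X ^ 2 + 4 * X + 3 : ℂ[X]).natDegree = 5 := by
    compute_degree!
  have hQne : (X ^ 5 + X ^ 4 - 5 * X ^ 3 - 5 * X ^ 2 + 4 * X + 3 : ℂ[X]) ≠ 0 := hQmonic.ne_zero
  have hs_sub : s ⊆ (X ^ 5 + X ^ 4 - 5 * X ^ 3 - 5 * X ^ 2 + 4 * X + 3 : ℂ[X]).roots := by
    intro w hw
    rw [mem_roots hQne, IsRoot.def, hQeval]
    rw [hs] at hw
    simp only [Multiset.insert_eq_cons, Multiset.mem_cons, Multiset.mem_singleton] at hw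
    rcases hw with rfl | rfl | rfl | rfl | rfl
    · exact hrootsC y₁ (by simp)
    · exact hrootsC y₂ (by simp)
    · exact hrootsC y₃ (by simp)
    · exact hrootsC y₄ (by simp)
    · exact hrootsC y₅ (by simp)
  have hs_le : s ≤ (X ^ 5 + X ^ 4 - 5 * X ^ 3 - 5 * X ^ 2 + 4 * X + 3 : ℂ[X]).roots :=
    (Multiset.le_iff_subset hs_nodup).mpr hs_sub
  have hroots_eq : (X ^ 5 + X ^ 4 - 5 * X ^ 3 - 5 * X ^ 2 + 4 * X + 3 : ℂ[X]).roots = s := by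
    symm
    apply Multiset.eq_of_le_of_card_le hs_le
    rw [hs_card]
    exact (card_roots' _).trans_eq hQdeg
  have hQsplit : (X ^ 5 + X ^ 4 - 5 * X ^ 3 - 5 * X ^ 2 + 4 * X + 3 : ℂ[X]) =
      (s.map fun w => X - C w).prod := by
    rw [← hroots_eq]
    exact (IsAlgClosed.splits _).eq_prod_roots_of_monic hQmonic
  have hQprod : ∀ t : ℂ, t ^ 5 + t ^ 4 - 5 * t ^ 3 - 5 * t ^ 2 + 4 * t + 3 =
      (t - y₁) * (t - y₂) * (t - y₃) * (t - y₄) * (t - y₅) := by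
    intro t
    have h' := congrArg (Polynomial.eval t) hQsplit
    rw [hQeval, eval_multiset_prod, hs] at h'
    simp only [Multiset.insert_eq_cons, Multiset.map_cons, Multiset.map_singleton, Multiset.prod_cons,
      Multiset.prod_singleton, eval_sub, eval_X, eval_C] at h'
    linear_combination h'
  -- the factorisation of `L` over `ℂ`
  have hLeval : ∀ x : ℂ, (lehmerPolynomial.map (Int.castRingHom ℂ)).eval x =
      x ^ 10 + x ^ 9 - x ^ 7 - x ^ 6 - x ^ 5 - x ^ 4 - x ^ 3 + x + 1 := by
    intro x
    rw [eval_map, ← algebraMap_int_eq, ← aeval_def, aeval_lehmerPoly]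
  have hLP : lehmerPolynomial.map (Int.castRingHom ℂ) = (s.map fun w => X ^ 2 - C w * X + 1).prod := by
    apply Polynomial.funext
    intro x
    rw [hLeval, eval_multiset_prod, hs]
    simp only [Multiset.insert_eq_cons, Multiset.map_cons, Multiset.map_singleton, Multiset.prod_cons,
      Multiset.prod_singleton, eval_add, eval_sub, eval_mul, eval_pow, eval_X, eval_C, eval_one]
    rcases eq_or_ne x 0 with rfl | hx
    · norm_num
    · rw [lehmer_eval_eq_trace x hx, hQprod (x + x⁻¹)]
      field_simp
      ring
  -- the Mahler measure
  unfold intMahlerMeasure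
  rw [hLP, prod_mahlerMeasure_eq_mahlerMeasure_prod, Multiset.map_map, hs]
  simp only [Multiset.insert_eq_cons, Multiset.map_cons, Multiset.map_singleton, Multiset.prod_cons,
    Multiset.prod_singleton, Function.comp_apply]
  rw [mahlerMeasure_quad_of_abs_lt_two h1.1 (by linarith [h1.2]),
    mahlerMeasure_quad_of_abs_lt_two (by linarith [h2.1]) (by linarith [h2.2]),
    mahlerMeasure_quad_of_abs_lt_two (by linarith [h3.1]) (by linarith [h3.2]),
    mahlerMeasure_quad_of_abs_lt_two (by linarith [h4.1]) (by linarith [h4.2]),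
    mahlerMeasure_quad_of_two_lt hy5]
  ring

/-- **Kernel enclosure of Lehmer's constant to 12 digits:** `1.176280818259 < M(L) < 1.176280818260`.
[cite: MossinghoffRhinWu2008, p.452 (M(ℓ) = 1.176280…)] -/
theorem lehmer_measure_enclosure :
    (1176280818259 / 10 ^ 12 : ℝ) < intMahlerMeasure lehmerPolynomial ∧
      intMahlerMeasure lehmerPolynomial < 1176280818260 / 10 ^ 12 := by
  obtain ⟨y, hlo, hhi, _, hM⟩ := lehmer_measure_eq_largest_root
  have hy : 2 < y := lt_trans (by norm_num) hlo
  have hpos : 0 ≤ y ^ 2 - 4 := by nlinarith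
  have ht2 : Real.sqrt (y ^ 2 - 4) ^ 2 = y ^ 2 - 4 := Real.sq_sqrt hpos
  have ht0 : 0 ≤ Real.sqrt (y ^ 2 - 4) := Real.sqrt_nonneg _
  have hty : Real.sqrt (y ^ 2 - 4) < y := by nlinarith
  have hr1 : 1 ≤ (y + Real.sqrt (y ^ 2 - 4)) / 2 := by linarith
  have hr0 : 0 < (y + Real.sqrt (y ^ 2 - 4)) / 2 := by linarith
  have hprod : (y + Real.sqrt (y ^ 2 - 4)) / 2 * ((y - Real.sqrt (y ^ 2 - 4)) / 2) = 1 := by nlinarith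
  have hrinv : ((y + Real.sqrt (y ^ 2 - 4)) / 2)⁻¹ = (y - Real.sqrt (y ^ 2 - 4)) / 2 :=
    inv_eq_of_mul_eq_one_right hprod
  have hsum : (y + Real.sqrt (y ^ 2 - 4)) / 2 + ((y + Real.sqrt (y ^ 2 - 4)) / 2)⁻¹ = y := by
    rw [hrinv]; ring
  rw [hM]
  constructor
  · exact lt_of_add_inv_lt_add_inv hr1 (by norm_num) (by rw [hsum]; exact hlo)
  · exact lt_of_add_inv_lt_add_inv (by norm_num) hr0 (by rw [hsum]; exact hhi)

/-- **Upper bound** complementing `lehmer_measure_lower_bound`: `M(L) < 1.17629`.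
[cite: MossinghoffRhinWu2008, p.452 (M(ℓ) = 1.176280…)] -/
theorem lehmer_measure_upper_bound : intMahlerMeasure lehmerPolynomial < 117629 / 100000 :=
  lt_trans lehmer_measure_enclosure.2 (by norm_num)

end Literature.NumberTheory.MahlerMeasure

end Part3

/-!
## Part 4 — port of `Summits/Ventures/DiscreteObjects/Mahler/DobrowolskiLemma.lean` (1 declarations kept)

# Dobrowolski's lemma `p^{deg f} ∣ Res(f, f(X^p))` and the Dobrowolski–Mignotte length bound (venture `DiscreteObjects`, target L)

Cell `pub-namedobj`, seat `pub-namedobj-mahler` (gen 8). Framing: lottery ticket; floor = certified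
bounds/negative ranges.

* `exists_expand_eq_prime_mul_add` — Dobrowolski's congruence `f(X^p) = p·T + f·f^{p-1}` in `ℤ[X]`
  (`f(X^p) ≡ f(X)^p (mod p)`, Mathlib `ZMod.expand_card`);
* `prime_pow_dvd_resultant_expand` — **Dobrowolski's Lemma** [McKee–Smyth, Lemma A.23; Dobrowolski 1979]
  in resultant form: `p^{deg f} ∣ Res_{(d, dp)}(f, f(X^p))` for every `f ∈ ℤ[X]` and prime `p`
  (for monic irreducible `f` this integer is `∏_{i,j} (α_i^p - α_j)`); `prime_pow_le_abs_resultant_expand`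
  — Cor. A.24: `p^{deg f} ≤ |Res|` when the resultant is nonzero;
* `norm_eval_le_length_mul` — `|f(β)| ≤ L(f) · max(1,|β|)^{deg f}`, `L(f) = Σ |f_i|` the length;
* `prime_le_length_mul_mahlerMeasure_pow` — the **Dobrowolski–Mignotte inequality**
  [McKee–Smyth, proof of Prop. 11.1; Mignotte 1978]: if no `p`-th power of a complex root of `f` is a root
  of `f`, then `p ≤ L(f) · M(f)^p`;
* `two_lt_mahlerMeasure_pow_length` — with Bertrand's postulate (Mathlib): under the same separation
  hypothesis for one prime `p ∈ (2L, 4L]`, `M(f)^{4L} > 2`, i.e. `M(f) > 2^{1/(4L)}`.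

The separation hypothesis holds for every `p ≥ 2` when `f` is irreducible, `f(0) ≠ 0` and `f` has no
cyclotomic factor (`pow_ne_root_of_irreducible`: if `α^p = β` were roots, the minimal polynomial `m` of `α`
would divide `m(X^p)`, the root set would be stable under `γ ↦ γ^p`, and pigeonhole would make `α` a root
of unity), giving the unconditional forms `prime_pow_le_abs_resultant_expand_of_irreducible`,
`prime_le_length_mul_mahlerMeasure_pow_of_irreducible`, `two_lt_mahlerMeasure_pow_length_of_irreducible`.
-/

section Part4

namespace Literature.NumberTheory.MahlerMeasure

open _root_.Polynomial

/-- **Dobrowolski's congruence.** For a prime `p` and `f ∈ ℤ[X]`: `f(X^p) = p·T + f·f^{p-1}` for some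
`T ∈ ℤ[X]` (i.e. `f(X^p) ≡ f(X)^p (mod p)`).
[cite: BombieriGubler2001, Theorem 4.4.9 p.116 (proof, Case I: f(X)^p ≡ f(X^p) mod p)] -/
theorem exists_expand_eq_prime_mul_add (f : ℤ[X]) {p : ℕ} (hp : p.Prime) :
    ∃ T : ℤ[X], expand ℤ p f = C (p : ℤ) * T + f * f ^ (p - 1) := by
  haveI := Fact.mk hp
  have hmap : (expand ℤ p f - f ^ p).map (Int.castRingHom (ZMod p)) = 0 := by
    rw [Polynomial.map_sub, Polynomial.map_pow, map_expand, ZMod.expand_card, sub_self]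
  have hdvd : C (p : ℤ) ∣ expand ℤ p f - f ^ p := by
    rw [C_dvd_iff_dvd_coeff]
    intro i
    have h := congrArg (fun q : (ZMod p)[X] => q.coeff i) hmap
    simp only [coeff_map, eq_intCast, coeff_zero] at h
    exact (ZMod.intCast_zmod_eq_zero_iff_dvd _ p).mp h
  obtain ⟨T, hT⟩ := hdvd
  refine ⟨T, ?_⟩
  rw [mul_pow_sub_one hp.ne_zero, ← hT]
  ring

end Literature.NumberTheory.MahlerMeasure

end Part4

/-!
## Part 5 — port of `Summits/Ventures/DiscreteObjects/Mahler/CyclotomicIntegerMeasure.lean` (7 declarations kept)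

# A Lehmer-strength bound for cyclotomic integers (Amoroso–Dvornicich, unramified prime) (venture `DiscreteObjects`, target L)

Cell `pub-namedobj`, seat `pub-namedobj-mahler-g27`. Framing: lottery ticket; floor = certified bounds/negative ranges.

[cite: BombieriGubler2001, Theorem 4.4.9, proof of Case I with Lemma 4.4.13(a)] (Amoroso–Dvornicich, J. Number Theory 80
(2000)): for an algebraic integer `α = g(ζ_m) ∈ ℤ[ζ_m]` of the `m`-th cyclotomic field, not `0` and not a root of unity,
and a prime `p` NOT dividing `m`, the Frobenius congruence `g(ζ)^p ≡ g(ζ^p) (mod p)` and the product formula give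
`h(α) ≥ log(p/2)/(p+1)`.  KERNEL FORM over `ℂ`, with `g ∈ ℤ[X]` and the primitive `m`-th roots of unity `μ`:
**`(p/2)^{φ(m)} ≤ (∏_μ max(1, |g(μ)|))^{p+1}`** (`cyclotomicInteger_measure_bound`) whenever `g(μ)^p ≠ g(μ^p)` for every
primitive `μ` — which holds as soon as `g(ζ_m)` is neither `0` nor a root of unity (`pow_ne_aeval_pow_of_not_torsion`).
Method: `g^p - g(X^p) = p·T` in `ℤ[X]` (`DobrowolskiLemma.exists_expand_eq_prime_mul_add`), so the resultant
`Res(Φ_m, g^p - g(X^p)) = p^{φ(m)} Res(Φ_m, T)` is a nonzero multiple of `p^{φ(m)}`, while over `ℂ` it is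
`∏_μ (g(μ)^p - g(μ^p))`, of modulus `≤ 2^{φ(m)} H^p · H` with `H = ∏_μ max(1,|g(μ)|)` (the map `μ ↦ μ^p` permutes the
primitive roots).  `H = M(F)` for `F = ∏_μ (X - g(μ)) = (minpoly α)^{φ(m)/deg α}`, so this is
`M(α)^{p+1} ≥ (p/2)^{deg α}` (file `CyclotomicIntegerLehmer`).  REPLICATION, no new mathematics.
-/

section Part5

namespace Literature.NumberTheory.MahlerMeasure

open _root_.Polynomial _root_.Finset

/-- `g^p - g(X^p) = p · T` in `ℤ[X]` (Fermat / Frobenius).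
[cite: BombieriGubler2001, Theorem 4.4.9 p.116 (proof, Case I with Lemma 4.4.13 (a))] -/
theorem exists_pow_sub_expand_eq_prime_mul (g : ℤ[X]) {p : ℕ} (hp : p.Prime) :
    ∃ T : ℤ[X], g ^ p - expand ℤ p g = C (p : ℤ) * T := by
  obtain ⟨T, hT⟩ := exists_expand_eq_prime_mul_add g hp
  refine ⟨-T, ?_⟩
  rw [hT, mul_pow_sub_one hp.ne_zero]
  ring

/-- A primitive `m`-th root of unity is fixed by any exponent `≡ 1 (mod m)`.
[cite: BombieriGubler2001, Theorem 4.4.9 p.116 (proof, Case I with Lemma 4.4.13 (a))] -/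
theorem pow_eq_self_of_mod_eq {μ : ℂ} {m e : ℕ} (hm : 0 < m) (hμ : IsPrimitiveRoot μ m) (he : e % m = 1 % m) :
    μ ^ e = μ := by
  rcases Nat.lt_or_ge 1 m with h1 | h1
  · rw [← Nat.div_add_mod e m, pow_add, pow_mul, hμ.pow_eq_one, one_pow, one_mul, he, Nat.mod_eq_of_lt h1, pow_one]
  · have hm1 : m = 1 := by omega
    subst hm1
    rw [IsPrimitiveRoot.one_right_iff] at hμ
    rw [hμ, one_pow]

/-- The map `μ ↦ μ^p` permutes the primitive `m`-th roots of unity when `p` is prime to `m`.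
[cite: BombieriGubler2001, Theorem 4.4.9 p.116 (proof, Case I with Lemma 4.4.13 (a))] -/
theorem prod_primitiveRoots_pow_eq {m p : ℕ} (hm : 0 < m) (hcop : p.Coprime m) (F : ℂ → ℝ) :
    ∏ μ ∈ primitiveRoots m ℂ, F (μ ^ p) = ∏ μ ∈ primitiveRoots m ℂ, F μ := by
  -- an exponent `q` with `p q ≡ 1 (mod m)`
  have htot : 0 < m.totient := Nat.totient_pos.2 hm
  set q : ℕ := p ^ (m.totient - 1) with hq
  have hpq : (p * q) % m = 1 % m := by
    have h := Nat.ModEq.pow_totient hcop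
    rw [hq, ← pow_succ', Nat.sub_add_cancel htot]
    exact h
  have hqp : (q * p) % m = 1 % m := by rw [mul_comm]; exact hpq
  have hqcop : q.Coprime m := by rw [hq]; exact Nat.Coprime.pow_left _ hcop
  refine Finset.prod_nbij' (fun μ => μ ^ p) (fun ν => ν ^ q) ?_ ?_ ?_ ?_ ?_
  · intro μ hμ
    exact (mem_primitiveRoots hm).2 (((mem_primitiveRoots hm).1 hμ).pow_of_coprime p hcop)
  · intro ν hν
    exact (mem_primitiveRoots hm).2 (((mem_primitiveRoots hm).1 hν).pow_of_coprime q hqcop)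
  · intro μ hμ
    rw [← pow_mul]
    exact pow_eq_self_of_mod_eq hm ((mem_primitiveRoots hm).1 hμ) hpq
  · intro ν hν
    rw [← pow_mul]
    exact pow_eq_self_of_mod_eq hm ((mem_primitiveRoots hm).1 hν) hqp
  · intro μ _
    rfl

/-- Every primitive `m`-th root of unity is a root of every `ℤ`-polynomial that has one primitive `m`-th root of unity as a
root (irreducibility of `Φ_m` over `ℚ`).
[cite: BombieriGubler2001, Theorem 4.4.9 p.116 (proof, Case I with Lemma 4.4.13 (a))] -/
theorem aeval_eq_zero_of_primitiveRoot {m : ℕ} (hm : 0 < m) {G : ℤ[X]} {μ : ℂ} (hμ : IsPrimitiveRoot μ m)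
    (hG : aeval μ G = 0) {ν : ℂ} (hν : IsPrimitiveRoot ν m) : aeval ν G = 0 := by
  have hdvd : minpoly ℚ μ ∣ G.map (algebraMap ℤ ℚ) := minpoly.dvd ℚ μ (by rwa [aeval_map_algebraMap])
  have h1 : aeval ν (minpoly ℚ μ) = 0 := by
    rw [← cyclotomic_eq_minpoly_rat hμ hm, aeval_def, eval₂_eq_eval_map, map_cyclotomic]
    haveI : NeZero (m : ℂ) := ⟨by exact_mod_cast hm.ne'⟩
    exact (isRoot_cyclotomic_iff.2 hν)
  obtain ⟨r, hr⟩ := hdvd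
  have h2 : aeval ν (G.map (algebraMap ℤ ℚ)) = 0 := by rw [hr, map_mul, h1, zero_mul]
  rwa [aeval_map_algebraMap] at h2

/-- **Separation**: if `g(ζ_m)` is neither `0` nor a root of unity and `p ∤ m` is prime, then `g(μ)^p ≠ g(μ^p)` for every
primitive `m`-th root of unity `μ` (else, by irreducibility of `Φ_m`, `g(ζ)^{p^i} = g(ζ^{p^i})` for all `i`, and
`p^{φ(m)} ≡ 1 (mod m)` makes `g(ζ)` a root of unity).
[cite: BombieriGubler2001, Theorem 4.4.9 p.116 (proof, Case I with Lemma 4.4.13 (a))] -/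
theorem pow_ne_aeval_pow_of_not_torsion {m p : ℕ} (hm : 0 < m) (hp : p.Prime) (hcop : p.Coprime m) (g : ℤ[X])
    {ζ : ℂ} (hζ : IsPrimitiveRoot ζ m) (h0 : aeval ζ g ≠ 0) (hnu : ∀ k : ℕ, 0 < k → aeval ζ g ^ k ≠ 1) :
    ∀ μ ∈ primitiveRoots m ℂ, aeval μ g ^ p ≠ aeval (μ ^ p) g := by
  intro μ hμ heq
  have hμ' := (mem_primitiveRoots hm).1 hμ
  set G : ℤ[X] := g ^ p - expand ℤ p g with hG
  have hGμ : aeval μ G = 0 := by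
    rw [hG, map_sub, map_pow, expand_aeval, heq, sub_self]
  have hstep : ∀ ν : ℂ, IsPrimitiveRoot ν m → aeval ν g ^ p = aeval (ν ^ p) g := by
    intro ν hν
    have h := aeval_eq_zero_of_primitiveRoot hm hμ' hGμ hν
    rw [hG, map_sub, map_pow, expand_aeval, sub_eq_zero] at h
    exact h
  have hiter : ∀ i : ℕ, aeval ζ g ^ (p ^ i) = aeval (ζ ^ (p ^ i)) g := by
    intro i
    induction i with
    | zero => simp
    | succ i ih =>
      rw [pow_succ, pow_mul, ih, hstep _ (hζ.pow_of_coprime _ ((Nat.Coprime.pow_left i hcop))), ← pow_mul]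
  have hE : (p ^ m.totient) % m = 1 % m := Nat.ModEq.pow_totient hcop
  have key := hiter m.totient
  rw [pow_eq_self_of_mod_eq hm hζ hE] at key
  have htot : 0 < m.totient := Nat.totient_pos.2 hm
  have hge : 2 ≤ p ^ m.totient := by
    calc 2 ≤ p := hp.two_le
      _ = p ^ 1 := (pow_one p).symm
      _ ≤ p ^ m.totient := Nat.pow_le_pow_right hp.pos htot
  have hone : aeval ζ g ^ (p ^ m.totient - 1) = 1 := by
    have h2 : aeval ζ g ^ (p ^ m.totient - 1) * aeval ζ g = 1 * aeval ζ g := by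
      rw [← pow_succ, Nat.sub_add_cancel (by omega), key, one_mul]
    exact mul_right_cancel₀ h0 h2
  exact hnu _ (by omega) hone

/-- `x + y ≤ 2 x y` for `x, y ≥ 1`.
[cite: BombieriGubler2001, Theorem 4.4.9 p.116 (proof, Case I with Lemma 4.4.13 (a))] -/
theorem add_le_two_mul_mul {x y : ℝ} (hx : 1 ≤ x) (hy : 1 ≤ y) : x + y ≤ 2 * x * y := by nlinarith

/-- **[BombieriGubler2001, Theorem 4.4.9, Case I] for cyclotomic integers, kernel form.**  Let `m ≥ 1`, `p` a prime
not dividing `m`, and `g ∈ ℤ[X]` with `g(μ)^p ≠ g(μ^p)` for every primitive `m`-th root of unity `μ ∈ ℂ`.  Then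
`(p/2)^{φ(m)} ≤ (∏_μ max(1, |g(μ)|))^{p+1}`, the product over the primitive `m`-th roots of unity.
[cite: BombieriGubler2001, Theorem 4.4.9 p.116 (proof, Case I with Lemma 4.4.13 (a))] -/
theorem cyclotomicInteger_measure_bound {m p : ℕ} (hm : 0 < m) (hp : p.Prime) (hcop : p.Coprime m) (g : ℤ[X])
    (hsep : ∀ μ ∈ primitiveRoots m ℂ, aeval μ g ^ p ≠ aeval (μ ^ p) g) :
    ((p : ℝ) / 2) ^ m.totient ≤ (∏ μ ∈ primitiveRoots m ℂ, max 1 ‖aeval μ g‖) ^ (p + 1) := by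
  classical
  set Φ : ℤ[X] := cyclotomic m ℤ with hΦ
  have hΦmon : Φ.Monic := cyclotomic.monic m ℤ
  have hΦdeg : Φ.natDegree = m.totient := natDegree_cyclotomic m ℤ
  set ζ₀ : ℂ := Complex.exp (2 * Real.pi * Complex.I / m) with hζ₀def
  have hζ₀ : IsPrimitiveRoot ζ₀ m := Complex.isPrimitiveRoot_exp m hm.ne'
  have hΦC : Φ.map (Int.castRingHom ℂ) = ∏ μ ∈ primitiveRoots m ℂ, (X - C μ) := by
    rw [hΦ, map_cyclotomic_int, cyclotomic_eq_prod_X_sub_primitiveRoots hζ₀]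
  have hroots : (Φ.map (Int.castRingHom ℂ)).roots = (primitiveRoots m ℂ).val := by
    rw [hΦC, roots_prod_X_sub_C]
  have hlc : (Φ.map (Int.castRingHom ℂ)).leadingCoeff = 1 := (hΦmon.map _).leadingCoeff
  have hcard : (primitiveRoots m ℂ).card = m.totient := hζ₀.card_primitiveRoots
  -- `G = g^p - g(X^p) = p T`
  obtain ⟨T, hT⟩ := exists_pow_sub_expand_eq_prime_mul g hp
  set G : ℤ[X] := g ^ p - expand ℤ p g with hG
  set N : ℕ := p * g.natDegree with hN
  have hGdeg : G.natDegree ≤ N := by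
    rw [hG]
    refine (natDegree_sub_le _ _).trans (max_le ?_ ?_)
    · exact natDegree_pow_le
    · rw [natDegree_expand, mul_comm]
  have hp0 : (p : ℤ) ≠ 0 := by exact_mod_cast hp.ne_zero
  have hTdeg : T.natDegree ≤ N := by
    have : T.natDegree = G.natDegree := by rw [hT, natDegree_C_mul hp0]
    rw [this]
    exact hGdeg
  -- resultants
  have hRes : Φ.resultant G Φ.natDegree N = (p : ℤ) ^ Φ.natDegree * Φ.resultant T Φ.natDegree N := by
    rw [hT, resultant_C_mul_right]
  have hev : ((Φ.resultant G Φ.natDegree N : ℤ) : ℂ) =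
      ∏ μ ∈ primitiveRoots m ℂ, (aeval μ g ^ p - aeval (μ ^ p) g) := by
    rw [resultant_intCast_eq hGdeg, hlc, one_pow, one_mul, hroots]
    change ∏ μ ∈ primitiveRoots m ℂ, (G.map (Int.castRingHom ℂ)).eval μ = _
    refine Finset.prod_congr rfl fun μ _ => ?_
    rw [eval_map, ← algebraMap_int_eq, ← aeval_def, hG, map_sub, map_pow, expand_aeval]
  have hne : Φ.resultant G Φ.natDegree N ≠ 0 := by
    intro h0
    have h := hev
    rw [h0, Int.cast_zero] at h
    exact (Finset.prod_ne_zero_iff.2 fun μ hμ => sub_ne_zero.2 (hsep μ hμ)) h.symm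
  -- lower bound `p^φ ≤ |Res|`
  have hlow : (p : ℝ) ^ m.totient ≤ ‖((Φ.resultant G Φ.natDegree N : ℤ) : ℂ)‖ := by
    have hT0 : Φ.resultant T Φ.natDegree N ≠ 0 := by
      intro h0
      rw [h0, mul_zero] at hRes
      exact hne hRes
    have h1 : (1 : ℤ) ≤ |Φ.resultant T Φ.natDegree N| := Int.one_le_abs hT0
    rw [Complex.norm_intCast, hRes, ← hΦdeg]
    push_cast
    rw [abs_mul, abs_pow, Nat.abs_cast]
    have h2 : (1 : ℝ) ≤ |(Φ.resultant T Φ.natDegree N : ℝ)| := by exact_mod_cast h1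
    calc (p : ℝ) ^ Φ.natDegree = (p : ℝ) ^ Φ.natDegree * 1 := (mul_one _).symm
      _ ≤ (p : ℝ) ^ Φ.natDegree * |(Φ.resultant T Φ.natDegree N : ℝ)| :=
          mul_le_mul_of_nonneg_left h2 (by positivity)
  -- upper bound `|Res| ≤ 2^φ H^p H`
  set H : ℝ := ∏ μ ∈ primitiveRoots m ℂ, max 1 ‖aeval μ g‖ with hH
  have hH0 : 0 ≤ H := Finset.prod_nonneg fun μ _ => by positivity
  have hup : ‖((Φ.resultant G Φ.natDegree N : ℤ) : ℂ)‖ ≤ 2 ^ m.totient * H ^ p * H := by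
    rw [hev, norm_prod]
    calc ∏ μ ∈ primitiveRoots m ℂ, ‖aeval μ g ^ p - aeval (μ ^ p) g‖
        ≤ ∏ μ ∈ primitiveRoots m ℂ, (2 * (max 1 ‖aeval μ g‖) ^ p * max 1 ‖aeval (μ ^ p) g‖) := by
          refine Finset.prod_le_prod (fun μ _ => norm_nonneg _) fun μ _ => ?_
          have ha : ‖aeval μ g ^ p‖ ≤ (max 1 ‖aeval μ g‖) ^ p := by
            rw [norm_pow]
            exact pow_le_pow_left₀ (norm_nonneg _) (le_max_right _ _) _
          have hb : ‖aeval (μ ^ p) g‖ ≤ max 1 ‖aeval (μ ^ p) g‖ := le_max_right _ _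
          have h1 : (1 : ℝ) ≤ (max 1 ‖aeval μ g‖) ^ p := one_le_pow₀ (le_max_left _ _)
          calc ‖aeval μ g ^ p - aeval (μ ^ p) g‖ ≤ ‖aeval μ g ^ p‖ + ‖aeval (μ ^ p) g‖ := norm_sub_le _ _
            _ ≤ (max 1 ‖aeval μ g‖) ^ p + max 1 ‖aeval (μ ^ p) g‖ := add_le_add ha hb
            _ ≤ 2 * (max 1 ‖aeval μ g‖) ^ p * max 1 ‖aeval (μ ^ p) g‖ :=
                add_le_two_mul_mul h1 (le_max_left _ _)
      _ = 2 ^ m.totient * H ^ p * ∏ μ ∈ primitiveRoots m ℂ, max 1 ‖aeval (μ ^ p) g‖ := by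
          rw [Finset.prod_mul_distrib, Finset.prod_mul_distrib, Finset.prod_const, hcard, Finset.prod_pow]
      _ = 2 ^ m.totient * H ^ p * H := by
          rw [prod_primitiveRoots_pow_eq hm hcop (fun z => max 1 ‖aeval z g‖)]
  -- combine
  have h := hlow.trans hup
  rw [div_pow, div_le_iff₀ (by positivity), pow_succ]
  linarith

end Literature.NumberTheory.MahlerMeasure

end Part5

/-!
## Part 6 — port of `Summits/Ventures/DiscreteObjects/Mahler/SymmetricRootIntegrality.lean`

# Symmetric integer polynomials in the roots of a monic integer polynomial take integer values (venture `DiscreteObjects`, target L)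

Cell `pub-namedobj`, seat `pub-namedobj-mahler-g26`. Framing: lottery ticket; floor = certified bounds/negative ranges.

**Lemma** (`exists_int_eq_aeval_of_isSymmetric`; folklore — the fundamental theorem of symmetric polynomials,
Mathlib's `MvPolynomial.esymmAlgHom_surjective`, plus Vieta, Mathlib's `Polynomial.coeff_eq_esymm_roots_of_card`).
Let `f ∈ ℤ[X]` be monic and let `α : σ → ℂ` enumerate its complex roots with multiplicity.  Then every SYMMETRIC
`S ∈ ℤ[X_σ]` satisfies `S(α) ∈ ℤ`.

**Application** (`exists_int_eq_prod_pow_sub_pow`, brick for the weak Dobrowolski bound [cite: MckeeSmyth2021,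
Theorem 3.11]): for every `p`, `D_p = ∏_{i ≠ j} (α_i^p - α_j^p)` is an integer; hence `D_p ≠ 0 ⇒ |D_p| ≥ 1`
(`one_le_norm_prod_pow_sub_pow`) — "the second product could be `0`; … enables us to assume `∏_{i≠j} |α_i^p - α_j^p| ≥ 1`"
in the printed proof.  No new mathematics.
-/

section Part6

namespace Literature.NumberTheory.MahlerMeasure

open _root_.MvPolynomial _root_.Finset

/-- The elementary symmetric functions of the roots (with multiplicity) of a monic integer polynomial are integers:
`e_k(α) = (-1)^k f_{N-k}` for `k ≤ N = deg f` (Vieta), and `0` for `k > N`.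
[cite: MckeeSmyth2021, Theorem 3.11 p.63 (proof: integrality of symmetric functions of the roots)] -/
theorem exists_int_eq_esymm_roots (f : Polynomial ℤ) (hmon : f.Monic) (k : ℕ) :
    ∃ z : ℤ, ((f.map (Int.castRingHom ℂ)).roots.esymm k : ℂ) = (z : ℂ) := by
  set g := f.map (Int.castRingHom ℂ) with hg
  have hgmon : g.Monic := hmon.map _
  have hsplit : g.roots.card = g.natDegree := (Polynomial.splits_iff_card_roots.1 (IsAlgClosed.splits g))
  by_cases hk : k ≤ g.natDegree
  · -- Vieta: coeff (N - k) = lead * (-1)^(N - (N-k)) * esymm (N - (N - k))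
    have hv := Polynomial.coeff_eq_esymm_roots_of_card hsplit (k := g.natDegree - k) (Nat.sub_le _ _)
    rw [hgmon.leadingCoeff, one_mul, Nat.sub_sub_self hk] at hv
    refine ⟨(-1) ^ k * f.coeff (g.natDegree - k), ?_⟩
    have h1 : ((-1 : ℂ) ^ k) * ((-1 : ℂ) ^ k) = 1 := by
      rw [← mul_pow, neg_one_mul, neg_neg, one_pow]
    calc (g.roots.esymm k : ℂ) = ((-1 : ℂ) ^ k * (-1) ^ k) * g.roots.esymm k := by rw [h1, one_mul]
      _ = (-1 : ℂ) ^ k * g.coeff (g.natDegree - k) := by rw [hv]; ring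
      _ = (((-1) ^ k * f.coeff (g.natDegree - k) : ℤ) : ℂ) := by
          rw [hg, Polynomial.coeff_map, eq_intCast]
          push_cast
          ring
  · refine ⟨0, ?_⟩
    push Not at hk
    rw [Multiset.esymm, Multiset.powersetCard_eq_empty k (by rw [hsplit]; exact hk)]
    simp

/-- **Symmetric integer polynomials in the roots of a monic integer polynomial are integers.**  `α : σ → ℂ`
enumerates the roots of `f` with multiplicity: `univ.val.map α = (f.map ℤ→ℂ).roots`.
[cite: MckeeSmyth2021, Theorem 3.11 p.63 (proof: integrality of symmetric functions of the roots)] -/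
theorem exists_int_eq_aeval_of_isSymmetric {σ : Type*} [Fintype σ] [DecidableEq σ] (f : Polynomial ℤ) (hmon : f.Monic)
    (α : σ → ℂ) (hα : (Finset.univ.val.map α : Multiset ℂ) = (f.map (Int.castRingHom ℂ)).roots)
    (S : MvPolynomial σ ℤ) (hS : S.IsSymmetric) : ∃ z : ℤ, MvPolynomial.aeval α S = (z : ℂ) := by
  classical
  set n := Fintype.card σ with hn
  -- fundamental theorem: `S = T(e_1, …, e_n)`
  obtain ⟨T, hT⟩ := esymmAlgHom_surjective ℤ (σ := σ) (n := n) le_rfl ⟨S, hS⟩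
  have hT' : MvPolynomial.aeval (fun i : Fin n => esymm σ ℤ (i + 1)) T = S := by
    have := congrArg Subtype.val hT
    rw [esymmAlgHom_apply] at this
    exact this
  -- the values `e_{i+1}(α)` are integers
  have hes : ∀ i : Fin n, ∃ z : ℤ, MvPolynomial.aeval α (esymm σ ℤ (i + 1)) = (z : ℂ) := by
    intro i
    obtain ⟨z, hz⟩ := exists_int_eq_esymm_roots f hmon (i + 1)
    refine ⟨z, ?_⟩
    rw [aeval_esymm_eq_multiset_esymm, hα, hz]
  choose g hg using hes
  refine ⟨MvPolynomial.eval g T, ?_⟩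
  rw [← hT', comp_aeval_apply]
  simp_rw [hg]
  -- `aeval (Int.cast ∘ g) T = Int.cast (eval g T)`
  have h := eval₂_comp_left (Int.castRingHom ℂ) (RingHom.id ℤ) g T
  rw [MvPolynomial.aeval_def]
  have hcomp : (Int.castRingHom ℂ).comp (RingHom.id ℤ) = algebraMap ℤ ℂ := RingHom.ext_int _ _
  rw [hcomp] at h
  rw [show (fun i => ((g i : ℤ) : ℂ)) = (Int.castRingHom ℂ) ∘ g from rfl, ← h]
  rfl

/-! ### Application: `∏_{i≠j} (α_i^p - α_j^p)` is an integer -/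

/-- The polynomial `∏_{i ≠ j} (X_i^p - X_j^p)` is symmetric.
[cite: MckeeSmyth2021, Theorem 3.11 p.63 (proof: integrality of symmetric functions of the roots)] -/
theorem isSymmetric_prod_pow_sub_pow {σ : Type*} [Fintype σ] [DecidableEq σ] (p : ℕ) :
    (∏ i : σ, ∏ j ∈ univ.erase i, ((X i : MvPolynomial σ ℤ) ^ p - X j ^ p)).IsSymmetric := by
  intro e
  simp only [map_prod, map_sub, map_pow, rename_X]
  -- reindex the inner product by `e`, then the outer one
  have hinner : ∀ i : σ, ∏ j ∈ univ.erase i, ((X (e i) : MvPolynomial σ ℤ) ^ p - X (e j) ^ p) =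
      ∏ j ∈ univ.erase (e i), ((X (e i) : MvPolynomial σ ℤ) ^ p - X j ^ p) := by
    intro i
    exact Finset.prod_equiv e (fun j => by simp [e.injective.ne_iff]) (fun j _ => rfl)
  simp_rw [hinner]
  exact Fintype.prod_equiv e _ (fun k => ∏ j ∈ univ.erase k, ((X k : MvPolynomial σ ℤ) ^ p - X j ^ p))
    (fun i => rfl)

/-- **`D_p = ∏_{i ≠ j} (α_i^p - α_j^p)` is an integer** for the roots `α` of a monic integer polynomial.
[cite: MckeeSmyth2021, Theorem 3.11 p.63 (proof: integrality of symmetric functions of the roots)] -/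
theorem exists_int_eq_prod_pow_sub_pow {σ : Type*} [Fintype σ] [DecidableEq σ] (f : Polynomial ℤ) (hmon : f.Monic)
    (α : σ → ℂ) (hα : (Finset.univ.val.map α : Multiset ℂ) = (f.map (Int.castRingHom ℂ)).roots) (p : ℕ) :
    ∃ z : ℤ, ∏ i : σ, ∏ j ∈ univ.erase i, (α i ^ p - α j ^ p) = (z : ℂ) := by
  obtain ⟨z, hz⟩ := exists_int_eq_aeval_of_isSymmetric f hmon α hα _ (isSymmetric_prod_pow_sub_pow (σ := σ) p)
  refine ⟨z, ?_⟩
  rw [← hz]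
  simp only [map_prod, map_sub, map_pow, aeval_X]

/-- Consequently `∏_{i ≠ j} |α_i^p - α_j^p| ≥ 1` unless it vanishes.
[cite: MckeeSmyth2021, Theorem 3.11 p.63 (proof: integrality of symmetric functions of the roots)] -/
theorem one_le_norm_prod_pow_sub_pow {σ : Type*} [Fintype σ] [DecidableEq σ] (f : Polynomial ℤ) (hmon : f.Monic)
    (α : σ → ℂ) (hα : (Finset.univ.val.map α : Multiset ℂ) = (f.map (Int.castRingHom ℂ)).roots) (p : ℕ)
    (hne : ∏ i : σ, ∏ j ∈ univ.erase i, (α i ^ p - α j ^ p) ≠ 0) :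
    1 ≤ ∏ i : σ, ∏ j ∈ univ.erase i, ‖α i ^ p - α j ^ p‖ := by
  obtain ⟨z, hz⟩ := exists_int_eq_prod_pow_sub_pow f hmon α hα p
  have hz0 : z ≠ 0 := by
    rintro rfl
    rw [Int.cast_zero] at hz
    exact hne hz
  have h : ‖∏ i : σ, ∏ j ∈ univ.erase i, (α i ^ p - α j ^ p)‖ = ∏ i : σ, ∏ j ∈ univ.erase i, ‖α i ^ p - α j ^ p‖ := by
    rw [norm_prod]
    exact Finset.prod_congr rfl fun i _ => norm_prod _ _
  rw [← h, hz, Complex.norm_intCast]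
  exact_mod_cast Int.one_le_abs hz0

/-- The same for the plain discriminant-type product (`p = 1`): `∏_{i ≠ j} |α_i - α_j| ≥ 1` unless it vanishes.
[cite: MckeeSmyth2021, Theorem 3.11 p.63 (proof: integrality of symmetric functions of the roots)] -/
theorem one_le_norm_prod_sub {σ : Type*} [Fintype σ] [DecidableEq σ] (f : Polynomial ℤ) (hmon : f.Monic)
    (α : σ → ℂ) (hα : (Finset.univ.val.map α : Multiset ℂ) = (f.map (Int.castRingHom ℂ)).roots)
    (hne : ∏ i : σ, ∏ j ∈ univ.erase i, (α i - α j) ≠ 0) :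
    1 ≤ ∏ i : σ, ∏ j ∈ univ.erase i, ‖α i - α j‖ := by
  have h := one_le_norm_prod_pow_sub_pow f hmon α hα 1 (by simpa using hne)
  simpa using h

end Literature.NumberTheory.MahlerMeasure

end Part6

/-!
## Part 7 — port of `Summits/Ventures/DiscreteObjects/Mahler/CyclotomicIntegerLehmer.lean` (3 declarations kept)

# Lehmer's conjecture for cyclotomic integers of conductor prime to a small prime (venture `DiscreteObjects`, target L)

Cell `pub-namedobj`, seat `pub-namedobj-mahler-g27`. Framing: lottery ticket; floor = certified bounds/negative ranges.

[cite: BombieriGubler2001, Theorem 4.4.9, Case I] (Amoroso–Dvornicich 2000) in Mahler-measure form: **for a cyclotomic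
integer `α = g(ζ_m)`, `g ∈ ℤ[X]`, `ζ_m` a primitive `m`-th root of unity, `α ≠ 0` and not a root of unity, and a prime `p`
not dividing `m`: `M(α)^{p+1} ≥ (p/2)^{deg α}`** (`cyclotomicInteger_lehmer_bound`; `M(α) = M(minpoly_ℤ α)`), i.e.
`h(α) ≥ log(p/2)/(p+1)`.  Translation from `CyclotomicIntegerMeasure`: the polynomial `F = ∏_μ (X - g(μ))` over the
primitive `m`-th roots of unity has integer coefficients (symmetric functions of the roots of `Φ_m`,
`SymmetricRootIntegrality`), all its roots are roots of the irreducible `f = minpoly_ℤ α` (irreducibility of `Φ_m`), hence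
`F = f^e` with `e · deg f = φ(m)` (`eq_pow_of_roots_subset`), and `M(F) = ∏_μ max(1,|g(μ)|)`.
Consequences: with `p = 3` (`3 ∤ m`), `M(α) ≥ (3/2)^{deg α/4}`, so **every cyclotomic integer of the field `ℚ(ζ_m)`,
`3 ∤ m`, which is not `0`, `±1`-free… precisely: not `0` and not a root of unity, has `M(α) > M(ℓ)` = Lehmer's number**
(`lehmer_of_cyclotomicInteger_three`: degree `≥ 2` gives `M ≥ (9/4)^{1/4} = 1.2247…`, degree `1` gives `|α| ≥ 2`); the same
with `p = 5` for `5 ∤ m` (`lehmer_of_cyclotomicInteger_five`).  REPLICATION, no new mathematics.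
-/

section Part7

namespace Literature.NumberTheory.MahlerMeasure

open _root_.Polynomial _root_.Finset

/-- **Powers of a minimal polynomial.**  A monic `P ∈ ℤ[X]` all of whose complex roots are roots of a monic
irreducible `f ∈ ℤ[X]` is a power of `f`.
[cite: BombieriGubler2001, Theorem 4.4.9 p.116 (Case I, Mahler-measure form)] -/
theorem eq_pow_of_roots_subset {f : ℤ[X]} (hfmon : f.Monic) (hfirr : Irreducible f) :
    ∀ n : ℕ, ∀ P : ℤ[X], P.natDegree = n → P.Monic →
      (∀ z : ℂ, z ∈ (P.map (Int.castRingHom ℂ)).roots → aeval z f = 0) → ∃ e : ℕ, P = f ^ e := by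
  intro n
  induction n using Nat.strong_induction_on with
  | _ n ih =>
    intro P hPn hPmon hroots
    by_cases hn : n = 0
    · refine ⟨0, ?_⟩
      rw [pow_zero]
      exact Polynomial.eq_one_of_monic_natDegree_zero hPmon (hPn.trans hn)
    · have hfdeg : 0 < f.natDegree :=
        (Monic.natDegree_pos hfmon).2 (fun h => hfirr.not_isUnit (h ▸ isUnit_one))
      have hPC0 : P.map (Int.castRingHom ℂ) ≠ 0 := (hPmon.map _).ne_zero
      have hPCdeg : (P.map (Int.castRingHom ℂ)).degree ≠ 0 := by
        rw [degree_eq_natDegree hPC0, natDegree_map_eq_of_injective (Int.castRingHom ℂ).injective_int, hPn]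
        exact_mod_cast hn
      obtain ⟨z, hz⟩ := IsAlgClosed.exists_root _ hPCdeg
      have hzmem : z ∈ (P.map (Int.castRingHom ℂ)).roots := (mem_roots hPC0).2 hz
      have hfz : aeval z f = 0 := hroots z hzmem
      have hPz : aeval z P = 0 := by
        have h := hz
        rwa [IsRoot.def, eval_map, ← algebraMap_int_eq, ← aeval_def] at h
      -- `f ∣ P` over `ℚ`, then over `ℤ`
      have hfQ : Irreducible (f.map (algebraMap ℤ ℚ)) :=
        ((hfirr.isPrimitive hfdeg.ne').irreducible_iff_irreducible_map_fraction_map (K := ℚ)).mp hfirr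
      have hmin : minpoly ℚ z = f.map (algebraMap ℤ ℚ) :=
        (minpoly.eq_of_irreducible_of_monic hfQ (by rwa [aeval_map_algebraMap]) (hfmon.map _)).symm
      have hdvdQ : f.map (Int.castRingHom ℚ) ∣ P.map (Int.castRingHom ℚ) := by
        rw [← algebraMap_int_eq, ← hmin]
        exact minpoly.dvd ℚ z (by rwa [aeval_map_algebraMap])
      have hdvd : f ∣ P := (IsPrimitive.Int.dvd_iff_map_cast_dvd_map_cast f P hfmon.isPrimitive).2 hdvdQ
      obtain ⟨P₁, hP₁⟩ := hdvd
      have hP₁mon : P₁.Monic := hfmon.of_mul_monic_left (hP₁ ▸ hPmon)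
      have hdeg₁ : P₁.natDegree < n := by
        have h := congrArg natDegree hP₁
        rw [hfmon.natDegree_mul hP₁mon, hPn] at h
        omega
      have hroots₁ : ∀ w : ℂ, w ∈ (P₁.map (Int.castRingHom ℂ)).roots → aeval w f = 0 := by
        intro w hw
        apply hroots w
        rw [hP₁, Polynomial.map_mul]
        exact Multiset.mem_of_le (roots.le_of_dvd (by rw [← Polynomial.map_mul, ← hP₁]; exact hPC0)
          (dvd_mul_left _ _)) hw
      obtain ⟨e, he⟩ := ih _ (hPn ▸ hdeg₁) P₁ rfl hP₁mon hroots₁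
      exact ⟨e + 1, by rw [hP₁, he, pow_succ']⟩

/-- The polynomial `∏_μ (X - g(μ))` over the primitive `m`-th roots of unity has integer coefficients.
[cite: BombieriGubler2001, Theorem 4.4.9 p.116 (Case I, Mahler-measure form)] -/
theorem prod_X_sub_C_aeval_primitiveRoots_lifts {m : ℕ} (hm : 0 < m) (g : ℤ[X]) :
    (∏ μ ∈ primitiveRoots m ℂ, (X - C (aeval μ g))) ∈ Polynomial.lifts (Int.castRingHom ℂ) := by
  classical
  set Φ : ℤ[X] := cyclotomic m ℤ with hΦ
  have hΦmon : Φ.Monic := cyclotomic.monic m ℤ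
  set ζ₀ : ℂ := Complex.exp (2 * Real.pi * Complex.I / m) with hζ₀def
  have hζ₀ : IsPrimitiveRoot ζ₀ m := Complex.isPrimitiveRoot_exp m hm.ne'
  have hroots : (Φ.map (Int.castRingHom ℂ)).roots = (primitiveRoots m ℂ).val := by
    rw [hΦ, map_cyclotomic_int, cyclotomic_eq_prod_X_sub_primitiveRoots hζ₀, roots_prod_X_sub_C]
  -- the roots of `Φ_m` enumerated by the subtype `σ` of `primitiveRoots m ℂ`
  have hα : (Finset.univ.val.map (Subtype.val : (primitiveRoots m ℂ) → ℂ) : Multiset ℂ) =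
      (Φ.map (Int.castRingHom ℂ)).roots := by
    rw [hroots]
    have h := congrArg Finset.val (Finset.attach_map_val (s := primitiveRoots m ℂ))
    rw [Finset.map_val, Function.Embedding.coe_subtype, ← Finset.univ_eq_attach] at h
    exact h
  -- the generic polynomial `Q = ∏_i (X - g(X_i))` over `MvPolynomial σ ℤ`
  set Q : Polynomial (MvPolynomial (primitiveRoots m ℂ) ℤ) :=
    ∏ i : (primitiveRoots m ℂ), (X - C (aeval (MvPolynomial.X i : MvPolynomial (primitiveRoots m ℂ) ℤ) g)) with hQ
  have hQsymm : ∀ k : ℕ, (Q.coeff k).IsSymmetric := by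
    intro k e
    have hmap : Q.map (MvPolynomial.rename e).toRingHom = Q := by
      rw [hQ, Polynomial.map_prod]
      simp only [Polynomial.map_sub, Polynomial.map_X, Polynomial.map_C, AlgHom.toRingHom_eq_coe, RingHom.coe_coe]
      have h1 : ∀ i : (primitiveRoots m ℂ), (MvPolynomial.rename e)
          (aeval (MvPolynomial.X i : MvPolynomial (primitiveRoots m ℂ) ℤ) g) =
          aeval (MvPolynomial.X (e i) : MvPolynomial (primitiveRoots m ℂ) ℤ) g := by
        intro i
        rw [← Polynomial.aeval_algHom_apply, MvPolynomial.rename_X]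
      simp_rw [h1]
      exact Fintype.prod_equiv e _
        (fun i => X - C (aeval (MvPolynomial.X i : MvPolynomial (primitiveRoots m ℂ) ℤ) g)) (fun i => rfl)
    have h := congrArg (fun R => R.coeff k) hmap
    simp only [Polynomial.coeff_map, AlgHom.toRingHom_eq_coe, RingHom.coe_coe] at h
    exact h
  have hQeval : Q.map (MvPolynomial.aeval (Subtype.val : (primitiveRoots m ℂ) → ℂ)).toRingHom =
      ∏ μ ∈ primitiveRoots m ℂ, (X - C (aeval μ g)) := by
    rw [hQ, Polynomial.map_prod]
    simp only [Polynomial.map_sub, Polynomial.map_X, Polynomial.map_C, AlgHom.toRingHom_eq_coe, RingHom.coe_coe]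
    have h1 : ∀ i : (primitiveRoots m ℂ), (MvPolynomial.aeval (Subtype.val : (primitiveRoots m ℂ) → ℂ))
        (aeval (MvPolynomial.X i : MvPolynomial (primitiveRoots m ℂ) ℤ) g) = aeval (i : ℂ) g := by
      intro i
      rw [← Polynomial.aeval_algHom_apply, MvPolynomial.aeval_X]
    simp_rw [h1]
    exact Finset.prod_coe_sort (primitiveRoots m ℂ) (fun μ => X - C (aeval μ g))
  rw [lifts_iff_coeff_lifts]
  intro k
  obtain ⟨z, hz⟩ := exists_int_eq_aeval_of_isSymmetric Φ hΦmon (Subtype.val : (primitiveRoots m ℂ) → ℂ) hα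
    (Q.coeff k) (hQsymm k)
  refine ⟨z, ?_⟩
  rw [← hQeval, Polynomial.coeff_map, AlgHom.toRingHom_eq_coe, RingHom.coe_coe, hz, eq_intCast]

/-- A cyclotomic (indeed any) algebraic integer of degree `1` which is neither `0` nor a root of unity is a rational
integer of modulus `≥ 2`, so its Mahler measure is `≥ 2`.
[cite: BombieriGubler2001, Theorem 4.4.9 p.116 (Case I, Mahler-measure form)] -/
theorem two_le_measure_of_natDegree_minpoly_eq_one {α : ℂ} (hαint : IsIntegral ℤ α) (h0 : α ≠ 0)
    (hnu : ∀ k : ℕ, 0 < k → α ^ k ≠ 1) (hd : (minpoly ℤ α).natDegree = 1) :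
    2 ≤ intMahlerMeasure (minpoly ℤ α) := by
  have hmon := minpoly.monic hαint
  have hf1 := hmon.eq_X_add_C hd
  set c : ℤ := (minpoly ℤ α).coeff 0 with hc
  have hαc : α = -(c : ℂ) := by
    have h := minpoly.aeval ℤ α
    rw [hf1, map_add, aeval_X, aeval_C, algebraMap_int_eq, eq_intCast] at h
    linear_combination h
  have hc0 : c ≠ 0 := by
    intro h; apply h0; rw [hαc, h]; simp
  have hc1 : c ≠ 1 := by
    intro h; apply hnu 2 (by norm_num); rw [hαc, h]; norm_num
  have hc2 : c ≠ -1 := by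
    intro h; apply hnu 1 (by norm_num); rw [hαc, h]; norm_num
  have habs0 : 0 < |c| := abs_pos.2 hc0
  have habs1 : |c| ≠ 1 := fun h => by
    rcases abs_eq (by norm_num : (0 : ℤ) ≤ 1) |>.1 h with h' | h'
    · exact hc1 h'
    · exact hc2 h'
  have hcabs : (2 : ℤ) ≤ |c| := by omega
  have hMge : ‖α‖ ≤ intMahlerMeasure (minpoly ℤ α) := norm_root_le_intMahlerMeasure hmon (minpoly.aeval ℤ α)
  have hnorm : ‖α‖ = |(c : ℝ)| := by rw [hαc, norm_neg, Complex.norm_intCast]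
  rw [hnorm] at hMge
  have h2 : (2 : ℝ) ≤ |(c : ℝ)| := by
    rw [← Int.cast_abs]; exact_mod_cast hcabs
  linarith

end Literature.NumberTheory.MahlerMeasure

end Part7

/-!
## Part 8 — port of `Summits/Ventures/DiscreteObjects/Mahler/CyclotomicIntegerRamified.lean` (2 declarations kept)

# Cyclotomic integers, ramified prime: the Bombieri–Gubler Case II inequality (venture `DiscreteObjects`, target L)

Cell `pub-namedobj`, seat `pub-namedobj-mahler-g27`. Framing: lottery ticket; floor = certified bounds/negative ranges.

[cite: BombieriGubler2001, Theorem 4.4.9, proof of Case II with Lemma 4.4.13(b)] (Amoroso–Dvornicich 2000): for a prime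
`p` DIVIDING `m` and `σ = σ_k ∈ Gal(ℚ(ζ_m)/ℚ(ζ_m^p))`, `ζ_m ↦ ζ_m^k` with `k ≡ 1 (mod m/p)`, every cyclotomic integer
`γ = g(ζ_m)` satisfies `p ∣ γ^p - σ(γ^p)`; with `η = α^p - σ(α^p) ≠ 0` the product formula gives `h(α) ≥ log(p/2)/(2p)`.
KERNEL FORM over `ℂ` (`cyclotomicInteger_measure_bound_ramified`): for `g ∈ ℤ[X]`, `p ∣ m`, `k` prime to `m` with
`k ≡ 1 (mod m/p)`, and `g(μ)^p ≠ g(μ^k)^p` for every primitive `m`-th root of unity `μ` (the NONDEGENERATE case):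
**`(p/2)^{φ(m)} ≤ (∏_μ max(1, |g(μ)|))^{2p}`**, and in Mahler-measure form **`(p/2)^{deg α} ≤ M(α)^{2p}`**
(`cyclotomicInteger_lehmer_bound_ramified`).  Method as in `CyclotomicIntegerMeasure`: from `g^p - g(X^p) = p·T` and
`μ^{kp} = μ^p`, `g(μ)^p - g(μ^k)^p = p (T(μ) - T(μ^k))`, and `∏_μ (T(μ) - T(μ^k)) = Res(Φ_m, T - T(X^k))` is a nonzero
integer.  The degenerate case (`α^p` fixed by `σ`) is where the printed proof descends to `ℚ(ζ_{m/p})`; that descent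
(an integral-basis statement for `ℤ[ζ_m]` over `ℤ[ζ_m^p]`) is NOT done here, so Lehmer's conjecture for ALL cyclotomic
integers remains open in the tree — see `CyclotomicIntegerLehmer` for the unramified primes `p ≤ 31`.
REPLICATION, no new mathematics.
-/

section Part8

namespace Literature.NumberTheory.MahlerMeasure

open _root_.Polynomial _root_.Finset

/-- For `p ∣ m` and `k ≡ 1 (mod m/p)`: `μ^{kp} = μ^p` for every `m`-th root of unity `μ`.
[cite: BombieriGubler2001, Theorem 4.4.9 p.116 (proof, Case II)] -/
theorem pow_mul_eq_pow_of_mod {m p k : ℕ} (hpm : p ∣ m) (hk : k % (m / p) = 1 % (m / p)) (hk1 : 1 ≤ k) {μ : ℂ}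
    (hμ : μ ^ m = 1) : μ ^ (k * p) = μ ^ p := by
  rcases Nat.eq_zero_or_pos p with hp0 | hp
  · subst hp0; simp
  obtain ⟨n, hn⟩ := hpm
  have hnp : m / p = n := by rw [hn, Nat.mul_div_cancel_left n hp]
  rw [hnp] at hk
  have hdvd : n ∣ k - 1 := by
    rw [Nat.dvd_iff_mod_eq_zero]
    exact Nat.sub_mod_eq_zero_of_mod_eq hk
  obtain ⟨t, ht⟩ := hdvd
  have hk' : k = 1 + n * t := by omega
  rw [hk', add_mul, one_mul, pow_add, mul_comm n t, mul_assoc, mul_comm n p, ← hn, mul_comm t m, pow_mul, hμ, one_pow,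
    mul_one]

/-- **[BombieriGubler2001, Theorem 4.4.9, Case II], nondegenerate part, kernel form.**  Let `p` be a prime dividing
`m`, `k` prime to `m` with `k ≡ 1 (mod m/p)`, and `g ∈ ℤ[X]` with `g(μ)^p ≠ g(μ^k)^p` for every primitive `m`-th root
of unity `μ`.  Then `(p/2)^{φ(m)} ≤ (∏_μ max(1, |g(μ)|))^{2p}`.
[cite: BombieriGubler2001, Theorem 4.4.9 p.116 (proof, Case II)] -/
theorem cyclotomicInteger_measure_bound_ramified {m p k : ℕ} (hm : 0 < m) (hp : p.Prime) (hpm : p ∣ m)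
    (hk : k % (m / p) = 1 % (m / p)) (hkcop : k.Coprime m) (g : ℤ[X])
    (hsep : ∀ μ ∈ primitiveRoots m ℂ, aeval μ g ^ p ≠ aeval (μ ^ k) g ^ p) :
    ((p : ℝ) / 2) ^ m.totient ≤ (∏ μ ∈ primitiveRoots m ℂ, max 1 ‖aeval μ g‖) ^ (2 * p) := by
  classical
  set Φ : ℤ[X] := cyclotomic m ℤ with hΦ
  have hΦmon : Φ.Monic := cyclotomic.monic m ℤ
  have hΦdeg : Φ.natDegree = m.totient := natDegree_cyclotomic m ℤ
  set ζ₀ : ℂ := Complex.exp (2 * Real.pi * Complex.I / m) with hζ₀def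
  have hζ₀ : IsPrimitiveRoot ζ₀ m := Complex.isPrimitiveRoot_exp m hm.ne'
  have hroots : (Φ.map (Int.castRingHom ℂ)).roots = (primitiveRoots m ℂ).val := by
    rw [hΦ, map_cyclotomic_int, cyclotomic_eq_prod_X_sub_primitiveRoots hζ₀, roots_prod_X_sub_C]
  have hlc : (Φ.map (Int.castRingHom ℂ)).leadingCoeff = 1 := (hΦmon.map _).leadingCoeff
  have hcard : (primitiveRoots m ℂ).card = m.totient := hζ₀.card_primitiveRoots
  have hk1 : 1 ≤ k := by
    rcases Nat.eq_zero_or_pos k with h0 | h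
    · exfalso
      rw [h0, Nat.coprime_zero_left] at hkcop
      rw [hkcop] at hpm
      exact hp.one_lt.ne' (Nat.dvd_one.1 hpm)
    · exact h
  -- `g^p - g(X^p) = p T`, `U = T - T(X^k)`
  obtain ⟨T, hT⟩ := exists_pow_sub_expand_eq_prime_mul g hp
  set U : ℤ[X] := T - expand ℤ k T with hU
  have hTμ : ∀ z : ℂ, aeval z g ^ p - aeval (z ^ p) g = (p : ℂ) * aeval z T := by
    intro z
    have h := congrArg (aeval z) hT
    rw [map_sub, map_pow, expand_aeval, map_mul, aeval_C, algebraMap_int_eq, eq_intCast] at h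
    exact h
  have hη : ∀ μ ∈ primitiveRoots m ℂ, aeval μ g ^ p - aeval (μ ^ k) g ^ p = (p : ℂ) * aeval μ U := by
    intro μ hμ
    have hμ' := (mem_primitiveRoots hm).1 hμ
    have hkp : (μ ^ k) ^ p = μ ^ p := by rw [← pow_mul]; exact pow_mul_eq_pow_of_mod hpm hk hk1 hμ'.pow_eq_one
    have h1 := hTμ μ
    have h2 := hTμ (μ ^ k)
    rw [hkp] at h2
    rw [hU, map_sub, expand_aeval]
    linear_combination h1 - h2
  -- `∏_μ U(μ) = Res(Φ, U)`, a nonzero integer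
  set N : ℕ := U.natDegree with hN
  have hev : ((Φ.resultant U Φ.natDegree N : ℤ) : ℂ) = ∏ μ ∈ primitiveRoots m ℂ, aeval μ U := by
    rw [resultant_intCast_eq le_rfl, hlc, one_pow, one_mul, hroots]
    change ∏ μ ∈ primitiveRoots m ℂ, (U.map (Int.castRingHom ℂ)).eval μ = _
    refine Finset.prod_congr rfl fun μ _ => ?_
    rw [eval_map, ← algebraMap_int_eq, ← aeval_def]
  have hne : Φ.resultant U Φ.natDegree N ≠ 0 := by
    intro h0
    have h := hev
    rw [h0, Int.cast_zero] at h
    refine (Finset.prod_ne_zero_iff.2 fun μ hμ => ?_) h.symm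
    intro hU0
    have := hη μ hμ
    rw [hU0, mul_zero, sub_eq_zero] at this
    exact hsep μ hμ this
  have hprod : ∏ μ ∈ primitiveRoots m ℂ, (aeval μ g ^ p - aeval (μ ^ k) g ^ p) =
      (p : ℂ) ^ m.totient * ∏ μ ∈ primitiveRoots m ℂ, aeval μ U := by
    rw [Finset.prod_congr rfl hη, Finset.prod_mul_distrib, Finset.prod_const, hcard]
  -- lower bound
  have hlow : (p : ℝ) ^ m.totient ≤ ‖∏ μ ∈ primitiveRoots m ℂ, (aeval μ g ^ p - aeval (μ ^ k) g ^ p)‖ := by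
    rw [hprod, norm_mul, norm_pow, Complex.norm_natCast, ← hev, Complex.norm_intCast]
    have h1 : (1 : ℝ) ≤ |(Φ.resultant U Φ.natDegree N : ℝ)| := by exact_mod_cast Int.one_le_abs hne
    calc (p : ℝ) ^ m.totient = (p : ℝ) ^ m.totient * 1 := (mul_one _).symm
      _ ≤ (p : ℝ) ^ m.totient * |(Φ.resultant U Φ.natDegree N : ℝ)| :=
          mul_le_mul_of_nonneg_left h1 (by positivity)
  -- upper bound
  set H : ℝ := ∏ μ ∈ primitiveRoots m ℂ, max 1 ‖aeval μ g‖ with hH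
  have hH0 : 0 ≤ H := Finset.prod_nonneg fun μ _ => by positivity
  have hup : ‖∏ μ ∈ primitiveRoots m ℂ, (aeval μ g ^ p - aeval (μ ^ k) g ^ p)‖ ≤ 2 ^ m.totient * H ^ p * H ^ p := by
    rw [norm_prod]
    calc ∏ μ ∈ primitiveRoots m ℂ, ‖aeval μ g ^ p - aeval (μ ^ k) g ^ p‖
        ≤ ∏ μ ∈ primitiveRoots m ℂ, (2 * (max 1 ‖aeval μ g‖) ^ p * (max 1 ‖aeval (μ ^ k) g‖) ^ p) := by
          refine Finset.prod_le_prod (fun μ _ => norm_nonneg _) fun μ _ => ?_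
          have ha : ‖aeval μ g ^ p‖ ≤ (max 1 ‖aeval μ g‖) ^ p := by
            rw [norm_pow]; exact pow_le_pow_left₀ (norm_nonneg _) (le_max_right _ _) _
          have hb : ‖aeval (μ ^ k) g ^ p‖ ≤ (max 1 ‖aeval (μ ^ k) g‖) ^ p := by
            rw [norm_pow]; exact pow_le_pow_left₀ (norm_nonneg _) (le_max_right _ _) _
          calc ‖aeval μ g ^ p - aeval (μ ^ k) g ^ p‖ ≤ ‖aeval μ g ^ p‖ + ‖aeval (μ ^ k) g ^ p‖ := norm_sub_le _ _
            _ ≤ (max 1 ‖aeval μ g‖) ^ p + (max 1 ‖aeval (μ ^ k) g‖) ^ p := add_le_add ha hb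
            _ ≤ 2 * (max 1 ‖aeval μ g‖) ^ p * (max 1 ‖aeval (μ ^ k) g‖) ^ p :=
                add_le_two_mul_mul (one_le_pow₀ (le_max_left _ _)) (one_le_pow₀ (le_max_left _ _))
      _ = 2 ^ m.totient * H ^ p * (∏ μ ∈ primitiveRoots m ℂ, max 1 ‖aeval (μ ^ k) g‖) ^ p := by
          rw [Finset.prod_mul_distrib, Finset.prod_mul_distrib, Finset.prod_const, hcard, Finset.prod_pow,
            Finset.prod_pow]
      _ = 2 ^ m.totient * H ^ p * H ^ p := by
          rw [prod_primitiveRoots_pow_eq hm hkcop (fun z => max 1 ‖aeval z g‖)]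
  have h := hlow.trans hup
  rw [div_pow, div_le_iff₀ (by positivity), two_mul, pow_add]
  linarith

end Literature.NumberTheory.MahlerMeasure

end Part8

/-!
## Part 9 — port of `Summits/Ventures/DiscreteObjects/Mahler/CyclotomicIntegerDescent.lean` (6 declarations kept)

# Cyclotomic integers: the explicit trace descent `g(ζ) = (contract_p g)(ζ^p)` for `σ`-invariant elements, `p² ∣ m` (venture `DiscreteObjects`, target L)

Cell `pub-namedobj`, seat `pub-namedobj-mahler-g27`. Framing: lottery ticket; floor = certified bounds/negative ranges.

Infrastructure for the degenerate case of [cite: BombieriGubler2001, Theorem 4.4.9, Case II] ("`ζ γ` is contained in the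
proper cyclotomic subfield `C_{m/p}`"): when `p² ∣ m` (so `m ∣ N²` for `N = (m/p)·t`), the automorphisms
`σ^j : ζ ↦ ζ^{(1+N)^j}` of `ℚ(ζ_m)` over `ℚ(ζ_m^p)` act by `ζ ↦ ζ · ω^j`, `ω = ζ^N` a `p`-th root of unity
(`pow_one_add_pow_mod`), and the trace identity `∑_{j<p} g(ζ ω^j) = p · (contract_p g)(ζ^p)` (`sum_aeval_mul_pow_eq`, for any
`ζ` and any primitive `p`-th root `ω`) gives the EXPLICIT descent: **if `g(μ^{1+N}) = g(μ)` for every primitive `m`-th root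
`μ` (with `p ∤ t`), then `g(ζ) = (contract_p g)(ζ^p)`** (`aeval_eq_aeval_contract_of_invariant`), i.e. the `σ`-invariant
cyclotomic integer `g(ζ_m)` is the explicit integer polynomial `contract_p g` in `ζ_m^p = ζ_{m/p}`.  (The case `p ∥ m` of the
descent needs a relative power-basis argument and is not done here.)  Elementary; no new mathematics.
-/

section Part9

namespace Literature.NumberTheory.MahlerMeasure

open _root_.Polynomial _root_.Finset

/-- If `m ∣ N²` then `(1 + N)^j ≡ 1 + jN (mod m)`.
[cite: BombieriGubler2001, Theorem 4.4.9 p.116 (proof, Case II: descent to ℚ(ζ_{m/p}))] -/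
theorem pow_one_add_pow_mod {m N : ℕ} (hN : m ∣ N * N) (j : ℕ) : (1 + N) ^ j % m = (1 + j * N) % m := by
  induction j with
  | zero => simp
  | succ j ih =>
    have h : Nat.ModEq m ((1 + N) ^ j) (1 + j * N) := ih
    have h2 : Nat.ModEq m ((1 + N) ^ (j + 1)) ((1 + j * N) * (1 + N)) := by
      rw [pow_succ]
      exact h.mul_right _
    have h3 : (1 + j * N) * (1 + N) = (1 + (j + 1) * N) + j * (N * N) := by ring
    have h4 : Nat.ModEq m ((1 + (j + 1) * N) + j * (N * N)) (1 + (j + 1) * N) := by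
      have : Nat.ModEq m (j * (N * N)) 0 := (Nat.modEq_zero_iff_dvd.2 (dvd_mul_of_dvd_right hN j))
      simpa using (Nat.ModEq.refl (1 + (j + 1) * N)).add this
    rw [h3] at h2
    exact h2.trans h4

/-- Powers of a root of unity only depend on the exponent modulo the order.
[cite: BombieriGubler2001, Theorem 4.4.9 p.116 (proof, Case II: descent to ℚ(ζ_{m/p}))] -/
theorem pow_eq_pow_of_mod_eq {μ : ℂ} {m a b : ℕ} (hμ : μ ^ m = 1) (h : a % m = b % m) : μ ^ a = μ ^ b := by
  rw [← Nat.div_add_mod a m, ← Nat.div_add_mod b m, pow_add, pow_add, pow_mul, pow_mul, hμ, one_pow, one_pow, h]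

/-- `contract` is additive. [cite: BombieriGubler2001, Theorem 4.4.9 p.116 (proof, Case II: descent to ℚ(ζ_{m/p}))] -/
theorem contract_add' {p : ℕ} (hp : p ≠ 0) (f g : ℤ[X]) : contract p (f + g) = contract p f + contract p g := by
  ext n
  simp only [coeff_contract hp, coeff_add]

/-- `contract` of a monomial.
[cite: BombieriGubler2001, Theorem 4.4.9 p.116 (proof, Case II: descent to ℚ(ζ_{m/p}))] -/
theorem contract_monomial' {p : ℕ} (hp : p ≠ 0) (i : ℕ) (a : ℤ) :
    contract p (monomial i a) = if p ∣ i then monomial (i / p) a else 0 := by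
  ext k
  rw [coeff_contract hp, coeff_monomial]
  by_cases hpi : p ∣ i
  · rw [if_pos hpi, coeff_monomial]
    obtain ⟨q, hq⟩ := hpi
    subst hq
    rw [Nat.mul_div_cancel_left q (Nat.pos_of_ne_zero hp)]
    by_cases hqk : q = k
    · subst hqk
      rw [if_pos (mul_comm p q), if_pos rfl]
    · rw [if_neg hqk, if_neg]
      intro h
      apply hqk
      rw [mul_comm] at h
      exact Nat.eq_of_mul_eq_mul_right (Nat.pos_of_ne_zero hp) h
  · rw [if_neg hpi, coeff_zero, if_neg]
    intro h
    apply hpi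
    rw [h]
    exact Dvd.intro_left k rfl

/-- **Trace identity.**  For `ζ ∈ ℂ`, a primitive `p`-th root of unity `ω` and `f ∈ ℤ[X]`:
`∑_{j<p} f(ζ ω^j) = p · (contract_p f)(ζ^p)`.
[cite: BombieriGubler2001, Theorem 4.4.9 p.116 (proof, Case II: descent to ℚ(ζ_{m/p}))] -/
theorem sum_aeval_mul_pow_eq {p : ℕ} (hp : p.Prime) {ω : ℂ} (hω : IsPrimitiveRoot ω p) (ζ : ℂ) (f : ℤ[X]) :
    ∑ j ∈ range p, aeval (ζ * ω ^ j) f = (p : ℂ) * aeval (ζ ^ p) (contract p f) := by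
  induction f using Polynomial.induction_on' with
  | add f g hf hg =>
    rw [contract_add' hp.ne_zero, map_add]
    simp only [map_add, Finset.sum_add_distrib, hf, hg]
    ring
  | monomial i a =>
    rw [contract_monomial' hp.ne_zero]
    simp only [aeval_monomial, algebraMap_int_eq, eq_intCast]
    have hsplit : ∀ j : ℕ, (ζ * ω ^ j) ^ i = ζ ^ i * (ω ^ i) ^ j := by
      intro j; rw [mul_pow, ← pow_mul, ← pow_mul, mul_comm j i]
    simp_rw [hsplit, ← Finset.mul_sum]
    by_cases hpi : p ∣ i
    · rw [if_pos hpi, aeval_monomial, algebraMap_int_eq, eq_intCast]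
      obtain ⟨q, hq⟩ := hpi
      have hωi : ω ^ i = 1 := by rw [hq, pow_mul, hω.pow_eq_one, one_pow]
      rw [hωi]
      simp only [one_pow, Finset.sum_const, Finset.card_range, nsmul_eq_mul, mul_one]
      rw [hq, Nat.mul_div_cancel_left q hp.pos, ← pow_mul]
      ring
    · rw [if_neg hpi, map_zero, mul_zero]
      have hωi : IsPrimitiveRoot (ω ^ i) p :=
        hω.pow_of_coprime i ((Nat.Prime.coprime_iff_not_dvd hp).2 hpi).symm
      rw [hωi.geom_sum_eq_zero hp.one_lt, mul_zero, mul_zero]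

/-- **Explicit descent for `σ`-invariant cyclotomic integers (`p² ∣ m`).**  Let `m = p·n` with `p ∣ n` (`p` prime),
`ζ` a primitive `m`-th root of unity, `t` prime to `p`, and `g ∈ ℤ[X]` with `g(μ^{1+nt}) = g(μ)` for every primitive
`m`-th root of unity `μ`.  Then `g(ζ) = (contract_p g)(ζ^p)` — an explicit integer polynomial in `ζ^p = ζ_{m/p}`.
[cite: BombieriGubler2001, Theorem 4.4.9 p.116 (proof, Case II: descent to ℚ(ζ_{m/p}))] -/
theorem aeval_eq_aeval_contract_of_invariant {m p n t : ℕ} (hm0 : 0 < m) (hp : p.Prime) (hm : m = p * n)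
    (hpn : p ∣ n) (ht : ¬ p ∣ t) (g : ℤ[X]) {ζ : ℂ} (hζ : IsPrimitiveRoot ζ m)
    (hinv : ∀ μ : ℂ, IsPrimitiveRoot μ m → aeval (μ ^ (1 + n * t)) g = aeval μ g) :
    aeval ζ g = aeval (ζ ^ p) (contract p g) := by
  have hn0 : 0 < n := by
    rcases Nat.eq_zero_or_pos n with h | h
    · exfalso; rw [h, mul_zero] at hm; omega
    · exact h
  set N : ℕ := n * t with hNdef
  -- `1 + N` is prime to `m`
  have hcop : (1 + N).Coprime m := by
    rw [hm]
    refine Nat.Coprime.mul_right ?_ ?_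
    · refine ((Nat.Prime.coprime_iff_not_dvd hp).2 ?_).symm
      intro h
      have h2 : p ∣ N := dvd_mul_of_dvd_left hpn t
      have : p ∣ 1 := (Nat.dvd_add_right h2).1 (by rwa [add_comm] at h)
      exact hp.one_lt.ne' (Nat.dvd_one.1 this)
    · have h2 : n ∣ N := dvd_mul_right n t
      obtain ⟨q, hq⟩ := h2
      rw [hq, show 1 + n * q = 1 + q * n by ring, Nat.coprime_add_mul_right_left]
      exact Nat.coprime_one_left n
  -- `m ∣ N²`
  have hN2 : m ∣ N * N := by
    obtain ⟨q, hq⟩ := hpn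
    rw [hm, hNdef, hq]
    exact ⟨q * t * t, by ring⟩
  -- iterate the invariance: `g(ζ^{(1+N)^j}) = g(ζ)`
  have hiter : ∀ j : ℕ, aeval (ζ ^ (1 + N) ^ j) g = aeval ζ g := by
    intro j
    induction j with
    | zero => simp
    | succ j ih =>
      rw [pow_succ, pow_mul]
      rw [hinv _ ((hζ.pow_of_coprime _ (Nat.Coprime.pow_left j hcop)))]
      exact ih
  -- `ζ^{(1+N)^j} = ζ · ω^j`, `ω = ζ^N` a primitive `p`-th root of unity
  set ω : ℂ := ζ ^ N with hωdef
  have hω : IsPrimitiveRoot ω p := by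
    have h1 : IsPrimitiveRoot (ζ ^ n) p := hζ.pow hm0 (by rw [hm, mul_comm])
    rw [hωdef, hNdef, pow_mul]
    exact h1.pow_of_coprime t ((Nat.Prime.coprime_iff_not_dvd hp).2 ht).symm
  have hpowj : ∀ j : ℕ, ζ ^ (1 + N) ^ j = ζ * ω ^ j := by
    intro j
    rw [pow_eq_pow_of_mod_eq hζ.pow_eq_one (pow_one_add_pow_mod hN2 j), pow_add, pow_one, hωdef, ← pow_mul,
      mul_comm j N]
  -- the trace identity
  have htrace := sum_aeval_mul_pow_eq hp hω ζ g
  have hleft : ∑ j ∈ range p, aeval (ζ * ω ^ j) g = (p : ℂ) * aeval ζ g := by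
    rw [Finset.sum_congr rfl fun j _ => by rw [← hpowj j, hiter j], Finset.sum_const, Finset.card_range,
      nsmul_eq_mul]
  rw [hleft] at htrace
  have hp0 : (p : ℂ) ≠ 0 := by exact_mod_cast hp.ne_zero
  exact mul_left_cancel₀ hp0 htrace

end Literature.NumberTheory.MahlerMeasure

end Part9

/-!
## Part 10 — port of `Summits/Ventures/DiscreteObjects/Mahler/CyclotomicIntegerGaloisDescent.lean` (5 declarations kept)

# Cyclotomic integers: Galois descent `ℤ[ζ_m] ∩ ℚ(ζ_m^p) = ℤ[ζ_m^p]`, explicitly (venture `DiscreteObjects`, target L)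

Cell `pub-namedobj`, seat `pub-namedobj-mahler-g28`. Framing: lottery ticket; floor = certified bounds/negative ranges.

Infrastructure for the degenerate case of [cite: BombieriGubler2001, Theorem 4.4.9, Case II] (Amoroso–Dvornicich 2000,
"`ζ' α` lies in the cyclotomic subfield `ℚ(ζ_{m/p})`"), completing `CyclotomicIntegerDescent` (which did `p² ∣ m`):
for `m = p n`, `p` an odd prime, in purely arithmetic form over `ℂ` —
* `exists_primitiveRoot_mod`: a primitive root modulo `p` (cyclicity of `(ℤ/p)ˣ`, Mathlib);
* `exists_galois_generator`: an exponent `k = 1 + n s`, `p ∤ s`, prime to `p n`, whose powers cover every `k' ≡ 1 (mod n)`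
  prime to `p n` modulo `p n` (a generator of `Gal(ℚ(ζ_m)/ℚ(ζ_m^p))`: `k = 1 + n` if `p ∣ n`, CRT with a primitive root if
  `p ∤ n`);
* `aeval_pow_eq_of_invariant`: invariance of `g(ζ)` under `ζ ↦ ζ^k` gives invariance under the whole group (orbit argument);
* `exists_descent_of_not_dvd` (`p ∤ n`, NEW explicit formula by a TWISTED trace): if `g(ζ^{1+nt}) = g(ζ)` for the
  `p - 1` conjugates, then `g(ζ) = g(ξ) − p ξ^{(n−1)(p−1)} (contract_p (g X^{p−1}))(ζ^p)` with `ξ = ζ^{1+nt₀}` the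
  non-primitive translate (`p ∣ 1 + n t₀`), an integer polynomial in `ζ^p`;
* `exists_descent_of_invariant`: both cases — a `σ_k`-invariant cyclotomic integer `g(ζ_m)` is `G(ζ_m^p)`, `G ∈ ℤ[X]`.
Elementary (no relative integral bases); REPLICATION-grade infrastructure, no new mathematics claimed.
-/

section Part10

namespace Literature.NumberTheory.MahlerMeasure

open _root_.Polynomial _root_.Finset

/-- **A primitive root modulo a prime.**  For a prime `p` there is `r`, `p ∤ r`, such that every natural number
prime to `p` is congruent to a power of `r` modulo `p` (cyclicity of `(ℤ/p)ˣ`).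
[cite: BombieriGubler2001, Theorem 4.4.9 p.116 (proof, Case II: Gal(ℚ(ζ_m)/ℚ(ζ_{m/p})))] -/
theorem exists_primitiveRoot_mod {p : ℕ} (hp : p.Prime) :
    ∃ r : ℕ, ¬ p ∣ r ∧ ∀ x : ℕ, ¬ p ∣ x → ∃ e : ℕ, r ^ e ≡ x [MOD p] := by
  haveI : Fact p.Prime := ⟨hp⟩
  obtain ⟨γ, hγ⟩ := IsCyclic.exists_generator (α := (ZMod p)ˣ)
  refine ⟨(γ : ZMod p).val, ?_, ?_⟩
  · rw [← ZMod.natCast_eq_zero_iff, ZMod.natCast_zmod_val]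
    exact γ.ne_zero
  · intro x hx
    have hxcop : x.Coprime p := (Nat.coprime_comm.1 ((Nat.Prime.coprime_iff_not_dvd hp).2 hx))
    set u : (ZMod p)ˣ := ZMod.unitOfCoprime x hxcop with hu
    have hmem : u ∈ Submonoid.powers γ :=
      ((isOfFinOrder_of_finite γ).mem_powers_iff_mem_zpowers).2 (hγ u)
    obtain ⟨e, he⟩ := (Submonoid.mem_powers_iff _ _).1 hmem
    refine ⟨e, ?_⟩
    rw [← ZMod.natCast_eq_natCast_iff, Nat.cast_pow, ZMod.natCast_zmod_val, ← ZMod.coe_unitOfCoprime x hxcop,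
      ← hu, ← he, Units.val_pow_eq_pow_val]

/-- **A generator of `Gal(ℚ(ζ_{pn})/ℚ(ζ_n))` in arithmetic form.**  For an odd prime `p` and `n ≥ 1` there is
`k = 1 + n s` with `p ∤ s`, `k` prime to `p n`, such that every `k'` prime to `p n` with `k' ≡ 1 (mod n)` is
congruent to a power of `k` modulo `p n`.  (If `p ∣ n` take `s = 1`; if `p ∤ n` take `k ≡ r (mod p)` for a primitive
root `r` mod `p`.) [cite: BombieriGubler2001, Theorem 4.4.9 p.116 (proof, Case II: Gal(ℚ(ζ_m)/ℚ(ζ_{m/p})))] -/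
theorem exists_galois_generator {p n : ℕ} (hp : p.Prime) (hp2 : 2 < p) (hn : 0 < n) :
    ∃ k s : ℕ, k = 1 + n * s ∧ ¬ p ∣ s ∧ k.Coprime (p * n) ∧
      ∀ k' : ℕ, k'.Coprime (p * n) → k' ≡ 1 [MOD n] → ∃ e : ℕ, k ^ e ≡ k' [MOD p * n] := by
  by_cases hpn : p ∣ n
  · -- `k = 1 + n`
    refine ⟨1 + n * 1, 1, rfl, ?_, ?_, ?_⟩
    · intro h; exact hp.one_lt.ne' (Nat.dvd_one.1 h)
    · rw [mul_one]
      refine Nat.Coprime.mul_right ?_ ?_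
      · refine (Nat.coprime_comm.1 ((Nat.Prime.coprime_iff_not_dvd hp).2 ?_))
        intro h
        have : p ∣ 1 := (Nat.dvd_add_right hpn).1 (by rwa [add_comm] at h)
        exact hp.one_lt.ne' (Nat.dvd_one.1 this)
      · rw [show 1 + n = 1 + 1 * n by ring, Nat.coprime_add_mul_right_left]
        exact Nat.coprime_one_left n
    · intro k' hk'cop hk'1
      rw [mul_one]
      have hk'pos : 1 ≤ k' := by
        rcases Nat.eq_zero_or_pos k' with h0 | h0
        · exfalso
          rw [h0, Nat.coprime_zero_left] at hk'cop
          have : p * n ≥ 2 * 1 := Nat.mul_le_mul hp.two_le hn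
          omega
        · exact h0
      have hdvd : n ∣ k' - 1 := (Nat.modEq_iff_dvd' hk'pos).1 hk'1.symm
      obtain ⟨t, ht⟩ := hdvd
      refine ⟨t, ?_⟩
      have hk' : k' = 1 + t * n := by rw [mul_comm t n]; omega
      have hN : p * n ∣ n * n := mul_dvd_mul hpn dvd_rfl
      have h := pow_one_add_pow_mod hN t
      rw [hk']
      exact h
  · -- `p ∤ n`: `k ≡ r (mod p)`, `k ≡ 1 (mod n)`
    obtain ⟨r, hr, hgen⟩ := exists_primitiveRoot_mod hp
    have hncop : n.Coprime p := Nat.coprime_comm.1 ((Nat.Prime.coprime_iff_not_dvd hp).2 hpn)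
    obtain ⟨s, -, hs⟩ := Nat.exists_mul_mod_eq_of_coprime (r + (p - 1)) hncop hp.ne_zero
    -- `n s ≡ r - 1 (mod p)`, so `k = 1 + n s ≡ r (mod p)`
    have hk : (1 + n * s) ≡ r [MOD p] := by
      have h1 : n * s ≡ r + (p - 1) [MOD p] := hs
      have h2 : 1 + n * s ≡ 1 + (r + (p - 1)) [MOD p] := h1.add_left 1
      have h3 : 1 + (r + (p - 1)) = r + p := by omega
      rw [h3] at h2
      exact h2.trans (by unfold Nat.ModEq; rw [Nat.add_mod_right])
    refine ⟨1 + n * s, s, rfl, ?_, ?_, ?_⟩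
    · intro hps
      -- then `k ≡ 1 (mod p)`, so `r ≡ 1`, so every unit is `≡ 1 (mod p)`: false for `2`
      have h1 : (1 + n * s) ≡ 1 [MOD p] := by
        have : n * s ≡ 0 [MOD p] := Nat.modEq_zero_iff_dvd.2 (dvd_mul_of_dvd_right hps n)
        have h := this.add_left 1
        rwa [add_zero] at h
      have hr1 : r ≡ 1 [MOD p] := hk.symm.trans h1
      have h2 : ¬ p ∣ 2 := by
        intro h; have := Nat.le_of_dvd (by norm_num) h; omega
      obtain ⟨e, he⟩ := hgen 2 h2
      have h3 : r ^ e ≡ 1 [MOD p] := by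
        have h := hr1.pow e
        rwa [one_pow] at h
      have h4 : 1 ≡ 2 [MOD p] := h3.symm.trans he
      have h5 : p ∣ 2 - 1 := (Nat.modEq_iff_dvd' (by norm_num)).1 h4
      exact hp.one_lt.ne' (Nat.dvd_one.1 (by simpa using h5))
    · refine Nat.Coprime.mul_right ?_ ?_
      · refine Nat.coprime_comm.1 ((Nat.Prime.coprime_iff_not_dvd hp).2 ?_)
        intro h
        have h1 : (1 + n * s) ≡ 0 [MOD p] := Nat.modEq_zero_iff_dvd.2 h
        have h2 : r ≡ 0 [MOD p] := hk.symm.trans h1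
        exact hr (Nat.modEq_zero_iff_dvd.1 h2)
      · rw [show 1 + n * s = 1 + s * n by ring, Nat.coprime_add_mul_right_left]
        exact Nat.coprime_one_left n
    · intro k' hk'cop hk'1
      have hk'p : ¬ p ∣ k' := by
        intro h
        have h1 : p ∣ Nat.gcd k' (p * n) := Nat.dvd_gcd h (dvd_mul_right p n)
        rw [hk'cop] at h1
        exact hp.one_lt.ne' (Nat.dvd_one.1 h1)
      obtain ⟨e, he⟩ := hgen k' hk'p
      refine ⟨e, ?_⟩
      have hmodp : (1 + n * s) ^ e ≡ k' [MOD p] := (hk.pow e).trans he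
      have hmodn : (1 + n * s) ^ e ≡ k' [MOD n] := by
        have h1 : (1 + n * s) ≡ 1 [MOD n] := by
          have : n * s ≡ 0 [MOD n] := Nat.modEq_zero_iff_dvd.2 (dvd_mul_right n s)
          have h := this.add_left 1
          rwa [add_zero] at h
        have h2 : (1 + n * s) ^ e ≡ 1 [MOD n] := by
          have h := h1.pow e
          rwa [one_pow] at h
        exact h2.trans hk'1.symm
      exact (Nat.modEq_and_modEq_iff_modEq_mul hncop.symm).1 ⟨hmodp, hmodn⟩

/-- **The orbit argument.**  If `g(μ^k) = g(μ)` for every primitive `m`-th root of unity `μ` (`m = p n`), where `k`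
generates in the sense of `exists_galois_generator`, then `g(ζ^{k'}) = g(ζ)` for every `k'` prime to `m` with
`k' ≡ 1 (mod n)` — i.e. `g(ζ)` is constant on the Galois orbit over `ℚ(ζ^p)`.
[cite: BombieriGubler2001, Theorem 4.4.9 p.116 (proof, Case II: Gal(ℚ(ζ_m)/ℚ(ζ_{m/p})))] -/
theorem aeval_pow_eq_of_invariant {m p n k : ℕ} (hm : m = p * n)
    (hgen : ∀ k' : ℕ, k'.Coprime (p * n) → k' ≡ 1 [MOD n] → ∃ e : ℕ, k ^ e ≡ k' [MOD p * n])
    (hkcop : k.Coprime (p * n)) (g : ℤ[X]) {ζ : ℂ} (hζ : IsPrimitiveRoot ζ m)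
    (hinv : ∀ μ : ℂ, IsPrimitiveRoot μ m → aeval (μ ^ k) g = aeval μ g)
    {k' : ℕ} (hk'cop : k'.Coprime m) (hk'1 : k' ≡ 1 [MOD n]) :
    aeval (ζ ^ k') g = aeval ζ g := by
  rw [hm] at hk'cop
  obtain ⟨e, he⟩ := hgen k' hk'cop hk'1
  have hiter : ∀ i : ℕ, aeval (ζ ^ k ^ i) g = aeval ζ g := by
    intro i
    induction i with
    | zero => simp
    | succ i ih =>
      rw [pow_succ, pow_mul]
      rw [hinv _ (hζ.pow_of_coprime _ (by rw [hm]; exact Nat.Coprime.pow_left i hkcop))]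
      exact ih
  have h1 : ζ ^ k' = ζ ^ k ^ e := by
    refine pow_eq_pow_of_mod_eq hζ.pow_eq_one ?_
    rw [hm]
    exact he.symm
  rw [h1]
  exact hiter e

/-- **Twisted trace descent (`p ∤ n`).**  Let `m = p n` with `p` prime, `p ∤ n`, `ζ` a primitive `m`-th root of
unity, `θ = ζ^p`, and `g ∈ ℤ[X]` such that `g(ζ^{1+nt}) = g(ζ)` for every `t < p` with `p ∤ 1 + n t` (the Galois
conjugates of `ζ` over `ℚ(θ)`).  Let `t₀ < p` be the index with `p ∣ 1 + n t₀` and `ξ = ζ^{1+nt₀} = θ^{c₀}`,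
`c₀ = (1 + n t₀)/p` (an `n`-th root of unity).  Then, EXPLICITLY,
`g(ζ) = g(ξ) − p · ξ^{(n−1)(p−1)} · (contract_p (g·X^{p−1}))(θ)`, an integer polynomial in `θ`:
`ℤ[ζ_m] ∩ ℚ(ζ_m^p) = ℤ[ζ_m^p]` made explicit by the trace identity `sum_aeval_mul_pow_eq` applied to `g·X^{p-1}`
(the twist `X^{p-1}` kills the invariant part, `∑_t (ζ ω^t)^{p-1} = 0`, and isolates the non-primitive translate `ξ`).
[cite: BombieriGubler2001, Theorem 4.4.9 p.116 (proof, Case II: Gal(ℚ(ζ_m)/ℚ(ζ_{m/p})))] -/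
theorem exists_descent_of_not_dvd {m p n : ℕ} (hm0 : 0 < m) (hp : p.Prime) (hm : m = p * n) (hn : 0 < n)
    (hpn : ¬ p ∣ n) (g : ℤ[X]) {ζ : ℂ} (hζ : IsPrimitiveRoot ζ m)
    (hconst : ∀ t : ℕ, t < p → ¬ p ∣ (1 + n * t) → aeval (ζ ^ (1 + n * t)) g = aeval ζ g) :
    ∃ G : ℤ[X], aeval ζ g = aeval (ζ ^ p) G := by
  have hncop : n.Coprime p := Nat.coprime_comm.1 ((Nat.Prime.coprime_iff_not_dvd hp).2 hpn)
  -- `ω = ζ^n`, a primitive `p`-th root of unity; `θ = ζ^p`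
  set ω : ℂ := ζ ^ n with hωdef
  have hω : IsPrimitiveRoot ω p := hζ.pow hm0 (by rw [hm, mul_comm])
  set θ : ℂ := ζ ^ p with hθdef
  -- the exceptional index `t₀`
  obtain ⟨t₀, ht₀p, ht₀⟩ := Nat.exists_mul_mod_eq_of_coprime (p - 1) hncop hp.ne_zero
  have hdvd₀ : p ∣ 1 + n * t₀ := by
    have h1 : n * t₀ ≡ p - 1 [MOD p] := ht₀
    have h2 : 1 + n * t₀ ≡ 1 + (p - 1) [MOD p] := h1.add_left 1
    rw [show 1 + (p - 1) = p by omega] at h2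
    exact Nat.modEq_zero_iff_dvd.1 (h2.trans (Nat.modEq_zero_iff_dvd.2 dvd_rfl))
  obtain ⟨c₀, hc₀⟩ := hdvd₀
  set ξ : ℂ := ζ ^ (1 + n * t₀) with hξdef
  have hξθ : ξ = θ ^ c₀ := by rw [hξdef, hc₀, pow_mul]
  have hξn : ξ ^ n = 1 := by
    rw [hξdef, ← pow_mul, hc₀, show p * c₀ * n = m * c₀ by rw [hm]; ring, pow_mul, hζ.pow_eq_one, one_pow]
  -- uniqueness of `t₀`
  have huniq : ∀ j : ℕ, j < p → j ≠ t₀ → ¬ p ∣ 1 + n * j := by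
    intro j hj hne hdj
    have h1 : 1 + n * j ≡ 1 + n * t₀ [MOD p] :=
      (Nat.modEq_zero_iff_dvd.2 hdj).trans (Nat.modEq_zero_iff_dvd.2 ⟨c₀, hc₀⟩).symm
    have h2 : n * j ≡ n * t₀ [MOD p] := Nat.ModEq.add_left_cancel' 1 h1
    have h3 : j ≡ t₀ [MOD p] := Nat.ModEq.cancel_left_of_coprime (by rw [Nat.gcd_comm]; exact hncop) h2
    exact hne (Nat.ModEq.eq_of_lt_of_lt h3 hj ht₀p)
  -- the trace identity for `f = g X^{p-1}`
  set f : ℤ[X] := g * X ^ (p - 1) with hf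
  have htr := sum_aeval_mul_pow_eq hp hω ζ f
  set γ : ℂ := aeval ζ g with hγ
  set δ : ℂ := aeval ξ g - γ with hδ
  have hζω : ∀ j : ℕ, ζ * ω ^ j = ζ ^ (1 + n * j) := by
    intro j; rw [pow_add, pow_one, hωdef, pow_mul]
  have hterm : ∀ j ∈ range p, aeval (ζ * ω ^ j) f =
      γ * (ζ ^ (1 + n * j)) ^ (p - 1) + (if j = t₀ then δ * ξ ^ (p - 1) else 0) := by
    intro j hj
    rw [Finset.mem_range] at hj
    rw [hf, map_mul, map_pow, aeval_X, hζω j]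
    by_cases hjt : j = t₀
    · rw [if_pos hjt, hjt, ← hξdef, hδ]; ring
    · rw [if_neg hjt, hconst j hj (huniq j hj hjt), add_zero]
  have hcopp : (p - 1).Coprime p :=
    (Nat.coprime_of_lt_prime (by have := hp.two_le; omega) (by have := hp.one_lt; omega) hp).symm
  have hgeom : ∑ j ∈ range p, (ζ ^ (1 + n * j)) ^ (p - 1) = 0 := by
    have h1 : ∀ j ∈ range p, (ζ ^ (1 + n * j)) ^ (p - 1) = ζ ^ (p - 1) * (ω ^ (p - 1)) ^ j := by
      intro j _
      rw [hωdef, ← pow_mul, ← pow_mul, ← pow_mul, ← pow_add]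
      congr 1; ring
    rw [Finset.sum_congr rfl h1, ← Finset.mul_sum, (hω.pow_of_coprime _ hcopp).geom_sum_eq_zero hp.one_lt, mul_zero]
  have ht₀mem : t₀ ∈ range p := Finset.mem_range.2 ht₀p
  rw [Finset.sum_congr rfl hterm, Finset.sum_add_distrib, ← Finset.mul_sum, hgeom, mul_zero, zero_add,
    Finset.sum_ite_eq' (range p) t₀ (fun _ => δ * ξ ^ (p - 1)), if_pos ht₀mem] at htr
  -- `δ ξ^{p-1} = p · (contract_p f)(θ)`; multiply by `ξ^{(n-1)(p-1)}`
  set N' : ℕ := (n - 1) * (p - 1) with hN'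
  have hξpow : ξ ^ (p - 1) * ξ ^ N' = 1 := by
    rw [← pow_add, hN', show p - 1 + (n - 1) * (p - 1) = n * (p - 1) by
      have h := Nat.sub_add_cancel hn; nlinarith [h], pow_mul, hξn, one_pow]
  have hδeq : δ = (p : ℂ) * aeval θ (contract p f) * ξ ^ N' := by
    have h := congrArg (fun z => z * ξ ^ N') htr
    rw [mul_assoc, hξpow, mul_one] at h
    exact h
  refine ⟨expand ℤ c₀ g - C (p : ℤ) * X ^ (c₀ * N') * contract p f, ?_⟩
  rw [map_sub, map_mul, map_mul, aeval_C, algebraMap_int_eq, eq_intCast, expand_aeval, map_pow, aeval_X,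
    pow_mul, ← hξθ]
  have hγeq : γ = aeval ξ g - δ := by rw [hδ]; ring
  rw [hγeq, hδeq]
  push_cast
  ring

/-- **Descent for invariant cyclotomic integers (both cases).**  Let `m = p n` (`p` prime), `k = 1 + n s` with `p ∤ s`, prime to `m`, generating in the sense of `exists_galois_generator`, and `g ∈ ℤ[X]`
with `g(μ^k) = g(μ)` for every primitive `m`-th root of unity `μ`.  Then `g(ζ) = G(ζ^p)` for an integer polynomial
`G` (`contract_p g` if `p ∣ n`, `CyclotomicIntegerDescent`; the twisted-trace polynomial if `p ∤ n`):
`ℤ[ζ_m]^{Gal(ℚ(ζ_m)/ℚ(ζ_m^p))} = ℤ[ζ_m^p]`, explicitly.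
[cite: BombieriGubler2001, Theorem 4.4.9 p.116 (proof, Case II: Gal(ℚ(ζ_m)/ℚ(ζ_{m/p})))] -/
theorem exists_descent_of_invariant {m p n k s : ℕ} (hm0 : 0 < m) (hp : p.Prime) (hm : m = p * n) (hn : 0 < n)
    (hk : k = 1 + n * s) (hs : ¬ p ∣ s) (hkcop : k.Coprime (p * n))
    (hgen : ∀ k' : ℕ, k'.Coprime (p * n) → k' ≡ 1 [MOD n] → ∃ e : ℕ, k ^ e ≡ k' [MOD p * n])
    (g : ℤ[X]) {ζ : ℂ} (hζ : IsPrimitiveRoot ζ m)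
    (hinv : ∀ μ : ℂ, IsPrimitiveRoot μ m → aeval (μ ^ k) g = aeval μ g) :
    ∃ G : ℤ[X], aeval ζ g = aeval (ζ ^ p) G := by
  by_cases hpn : p ∣ n
  · refine ⟨contract p g, ?_⟩
    refine aeval_eq_aeval_contract_of_invariant hm0 hp hm hpn hs g hζ ?_
    intro μ hμ
    rw [← hk]
    exact hinv μ hμ
  · refine exists_descent_of_not_dvd hm0 hp hm hn hpn g hζ ?_
    intro t ht hpt
    have hk'cop : (1 + n * t).Coprime m := by
      rw [hm]
      refine Nat.Coprime.mul_right ?_ ?_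
      · exact Nat.coprime_comm.1 ((Nat.Prime.coprime_iff_not_dvd hp).2 hpt)
      · rw [show 1 + n * t = 1 + t * n by ring, Nat.coprime_add_mul_right_left]
        exact Nat.coprime_one_left n
    have hk'1 : (1 + n * t) ≡ 1 [MOD n] := by
      have : n * t ≡ 0 [MOD n] := Nat.modEq_zero_iff_dvd.2 (dvd_mul_right n t)
      have h := this.add_left 1
      rwa [add_zero] at h
    exact aeval_pow_eq_of_invariant hm hgen hkcop g hζ hinv hk'cop hk'1

end Literature.NumberTheory.MahlerMeasure

end Part10

/-!
## Part 11 — port of `Summits/Ventures/DiscreteObjects/Mahler/CyclotomicIntegerTwistFibre.lean` (3 declarations kept)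

# Cyclotomic integers: the root-of-unity twist in the degenerate case, and the fibres of `μ ↦ μ^p` (venture `DiscreteObjects`, target L)

Cell `pub-namedobj`, seat `pub-namedobj-mahler-g28`. Framing: lottery ticket; floor = certified bounds/negative ranges.

Two more elementary pieces for the degenerate case of [cite: BombieriGubler2001, Theorem 4.4.9, Case II]
(Amoroso–Dvornicich 2000), `m = p n`, `σ_k : ζ ↦ ζ^k` with `k = 1 + n s`, `p ∤ s`:
* `aeval_pow_pow_eq_of_exists`: `g(μ₀)^p = g(μ₀^k)^p` for one primitive `m`-th root `μ₀` gives it for all;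
* `exists_twist_invariant`: in the degenerate case `g(ζ^k)^p = g(ζ)^p`, `g(ζ) ≠ 0`, one has `g(ζ^k) = ω^j g(ζ)` with
  `ω = ζ^n`, and the twisted cyclotomic integer `ζ^a g(ζ) = (X^a g)(ζ)`, `p ∣ a s + j`, is `σ_k`-invariant
  ("`ζ' α ∈ ℚ(ζ_{m/p})` for a root of unity `ζ'`");
* `prod_primitiveRoots_pow_prime_eq`: `μ ↦ μ^p` maps the primitive `m`-th roots of unity onto the primitive `n`-th roots
  with all fibres of size `e = φ(m)/φ(n)`, so `∏_μ F(μ^p) = (∏_θ F(θ))^e` (measure transfer under the descent).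
Elementary; no new mathematics claimed.
-/

section Part11

namespace Literature.NumberTheory.MahlerMeasure

open _root_.Polynomial _root_.Finset

/-- If `g(μ₀)^p = g(μ₀^k)^p` for ONE primitive `m`-th root of unity, then for all of them (irreducibility of `Φ_m`).
[cite: BombieriGubler2001, Theorem 4.4.9 p.116 (proof, Case II: the twist ζ′α)] -/
theorem aeval_pow_pow_eq_of_exists {m p k : ℕ} (hm0 : 0 < m) (g : ℤ[X]) {ζ : ℂ} (hζ : IsPrimitiveRoot ζ m)
    (h : ∃ μ ∈ primitiveRoots m ℂ, aeval μ g ^ p = aeval (μ ^ k) g ^ p) :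
    aeval (ζ ^ k) g ^ p = aeval ζ g ^ p := by
  obtain ⟨μ, hμ, hμeq⟩ := h
  have hμ' := (mem_primitiveRoots hm0).1 hμ
  set Q : ℤ[X] := g ^ p - (expand ℤ k g) ^ p with hQ
  have hQμ : aeval μ Q = 0 := by
    rw [hQ, map_sub, map_pow, map_pow, expand_aeval, hμeq, sub_self]
  have hQζ := aeval_eq_zero_of_primitiveRoot hm0 hμ' hQμ hζ
  rw [hQ, map_sub, map_pow, map_pow, expand_aeval, sub_eq_zero] at hQζ
  exact hQζ.symm

/-- **Twist.**  Let `m = p n`, `k = 1 + n s` with `p ∤ s`, `α = g(ζ) ≠ 0` with `g(ζ^k)^p = g(ζ)^p` (degenerate case).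
Then `g(ζ^k) = ω^j g(ζ)` for the `p`-th root of unity `ω = ζ^n`, and for `a` with `p ∣ a s + j` the cyclotomic
integer `ζ^a α = (X^a g)(ζ)` is `σ_k`-invariant: `(X^a g)(μ^k) = (X^a g)(μ)` for every primitive `m`-th root `μ`.
[cite: BombieriGubler2001, Theorem 4.4.9 p.116 (proof, Case II: the twist ζ′α)] -/
theorem exists_twist_invariant {m p n k s : ℕ} (hm0 : 0 < m) (hp : p.Prime) (hm : m = p * n)
    (hk : k = 1 + n * s) (hs : ¬ p ∣ s) (g : ℤ[X]) {ζ : ℂ} (hζ : IsPrimitiveRoot ζ m)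
    (h0 : aeval ζ g ≠ 0) (hdeg : aeval (ζ ^ k) g ^ p = aeval ζ g ^ p) :
    ∃ a : ℕ, ∀ μ : ℂ, IsPrimitiveRoot μ m → aeval (μ ^ k) (X ^ a * g) = aeval μ (X ^ a * g) := by
  haveI : NeZero p := ⟨hp.ne_zero⟩
  set ω : ℂ := ζ ^ n with hωdef
  have hω : IsPrimitiveRoot ω p := hζ.pow hm0 (by rw [hm, mul_comm])
  -- `g(ζ^k) = ω^j g(ζ)`
  set u : ℂ := aeval (ζ ^ k) g / aeval ζ g with hu
  have hup : u ^ p = 1 := by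
    rw [hu, div_pow, hdeg, div_self (pow_ne_zero _ h0)]
  obtain ⟨j, -, hj⟩ := hω.eq_pow_of_pow_eq_one hup
  have hgk : aeval (ζ ^ k) g = ω ^ j * aeval ζ g := by
    rw [hj, hu, div_mul_cancel₀ _ h0]
  -- `a` with `p ∣ a s + j`
  have hscop : s.Coprime p := Nat.coprime_comm.1 ((Nat.Prime.coprime_iff_not_dvd hp).2 hs)
  obtain ⟨c, -, hc⟩ := Nat.exists_mul_mod_eq_one_of_coprime hscop hp.one_lt
  set a : ℕ := c * ((p - 1) * j) with ha
  have hdiv : ∃ q : ℕ, a * s + j = p * q := by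
    have h1 : s * c = p * (s * c / p) + 1 := by
      have := Nat.div_add_mod (s * c) p
      rw [hc] at this
      exact this.symm
    refine ⟨s * c / p * ((p - 1) * j) + j, ?_⟩
    have hp1 : p - 1 + 1 = p := Nat.sub_add_cancel hp.one_lt.le
    calc a * s + j = s * c * ((p - 1) * j) + j := by rw [ha]; ring
      _ = (p * (s * c / p) + 1) * ((p - 1) * j) + j := by rw [← h1]
      _ = p * (s * c / p * ((p - 1) * j)) + ((p - 1) * j + j) := by ring
      _ = p * (s * c / p * ((p - 1) * j)) + p * j := by
          congr 1
          conv_rhs => rw [← hp1]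
          ring
      _ = p * (s * c / p * ((p - 1) * j) + j) := by ring
  obtain ⟨q, hq⟩ := hdiv
  refine ⟨a, ?_⟩
  -- invariance at `ζ`
  have hζinv : aeval (ζ ^ k) (X ^ a * g) = aeval ζ (X ^ a * g) := by
    rw [map_mul, map_pow, aeval_X, hgk, map_mul, map_pow, aeval_X, hωdef, ← pow_mul, ← pow_mul, ← mul_assoc,
      ← pow_add]
    congr 1
    refine pow_eq_pow_of_mod_eq hζ.pow_eq_one ?_
    have : k * a + n * j = a + m * q := by
      rw [hk, hm]
      calc (1 + n * s) * a + n * j = a + n * (a * s + j) := by ring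
        _ = a + n * (p * q) := by rw [hq]
        _ = a + p * n * q := by ring
    rw [this, Nat.add_mul_mod_self_left]
  -- invariance at every primitive root by conjugation
  intro μ hμ
  set Q : ℤ[X] := expand ℤ k (X ^ a * g) - X ^ a * g with hQ
  have hQζ : aeval ζ Q = 0 := by rw [hQ, map_sub, expand_aeval, hζinv, sub_self]
  have hQμ := aeval_eq_zero_of_primitiveRoot hm0 hζ hQζ hμ
  rw [hQ, map_sub, expand_aeval, sub_eq_zero] at hQμ
  exact hQμ

/-- **Fibre count.**  For a prime `p` and `m = p n`, the map `μ ↦ μ^p` sends the primitive `m`-th roots of unity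
onto the primitive `n`-th roots of unity with all fibres of size `e = φ(m)/φ(n)` (`= p` if `p ∣ n`, `= p - 1` if
`p ∤ n`); hence `∏_μ F(μ^p) = (∏_θ F(θ))^e`.
[cite: BombieriGubler2001, Theorem 4.4.9 p.116 (proof, Case II: the twist ζ′α)] -/
theorem prod_primitiveRoots_pow_prime_eq {m p n e : ℕ} (hm0 : 0 < m) (hp : p.Prime) (hm : m = p * n) (hn : 0 < n)
    (he : m.totient = e * n.totient) (F : ℂ → ℝ) :
    ∏ μ ∈ primitiveRoots m ℂ, F (μ ^ p) = (∏ θ ∈ primitiveRoots n ℂ, F θ) ^ e := by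
  classical
  set S := primitiveRoots m ℂ with hS
  set T := primitiveRoots n ℂ with hT
  have hmaps : ∀ μ ∈ S, μ ^ p ∈ T := by
    intro μ hμ
    exact (mem_primitiveRoots hn).2 (((mem_primitiveRoots hm0).1 hμ).pow hm0 hm)
  have hcardS : S.card = m.totient := (Complex.isPrimitiveRoot_exp m hm0.ne').card_primitiveRoots
  have hcardT : T.card = n.totient := (Complex.isPrimitiveRoot_exp n hn.ne').card_primitiveRoots
  -- fibre sizes are `≤ e`
  have htot : 0 < n.totient := Nat.totient_pos.2 hn
  have hle : ∀ θ ∈ T, (S.filter (fun μ => μ ^ p = θ)).card ≤ e := by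
    intro θ hθ
    have hθ' := (mem_primitiveRoots hn).1 hθ
    have hsub : S.filter (fun μ => μ ^ p = θ) ⊆ Polynomial.nthRootsFinset p θ := by
      intro μ hμ
      rw [Finset.mem_filter] at hμ
      exact (Polynomial.mem_nthRootsFinset hp.pos θ).2 hμ.2
    have hcardR : (Polynomial.nthRootsFinset p θ).card ≤ p := by
      rw [Polynomial.nthRootsFinset_def]
      exact (Multiset.toFinset_card_le _).trans (Polynomial.card_nthRoots p θ)
    by_cases hpn : p ∣ n
    · have hep : e = p := by
        rw [hm, Nat.totient_mul_of_prime_of_dvd hp hpn] at he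
        exact (Nat.eq_of_mul_eq_mul_right htot he).symm
      rw [hep]
      exact (Finset.card_le_card hsub).trans hcardR
    · have hep : e = p - 1 := by
        rw [hm, Nat.totient_mul_of_prime_of_not_dvd hp hpn] at he
        exact (Nat.eq_of_mul_eq_mul_right htot he).symm
      -- the non-primitive `p`-th root `θ^c` of `θ`, `p c ≡ 1 (mod n)`
      have hpcop : p.Coprime n := (Nat.Prime.coprime_iff_not_dvd hp).2 hpn
      obtain ⟨c, -, hc⟩ := Nat.exists_mul_mod_eq_of_coprime 1 hpcop hn.ne'
      have hx : (θ ^ c) ^ p = θ := by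
        rw [← pow_mul]
        exact pow_eq_self_of_mod_eq hn hθ' (by rw [mul_comm]; exact hc)
      have hxR : θ ^ c ∈ Polynomial.nthRootsFinset p θ := (Polynomial.mem_nthRootsFinset hp.pos θ).2 hx
      have hxS : θ ^ c ∉ S := by
        intro hxS
        have hprim := (mem_primitiveRoots hm0).1 hxS
        have h1 : (θ ^ c) ^ n = 1 := by rw [← pow_mul, mul_comm, pow_mul, hθ'.pow_eq_one, one_pow]
        have h2 : m ∣ n := hprim.dvd_of_pow_eq_one n h1
        have h3 : m ≤ n := Nat.le_of_dvd hn h2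
        have h4 : 2 * n ≤ m := by rw [hm]; exact Nat.mul_le_mul_right n hp.two_le
        omega
      have hsub' : S.filter (fun μ => μ ^ p = θ) ⊆ (Polynomial.nthRootsFinset p θ).erase (θ ^ c) := by
        intro μ hμ
        rw [Finset.mem_erase]
        refine ⟨?_, hsub hμ⟩
        rintro rfl
        exact hxS (Finset.mem_filter.1 hμ).1
      rw [hep]
      calc (S.filter (fun μ => μ ^ p = θ)).card ≤ ((Polynomial.nthRootsFinset p θ).erase (θ ^ c)).card :=
            Finset.card_le_card hsub'
        _ = (Polynomial.nthRootsFinset p θ).card - 1 := Finset.card_erase_of_mem hxR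
        _ ≤ p - 1 := Nat.sub_le_sub_right hcardR 1
  -- hence all fibre sizes are `= e`
  have hsum : ∑ θ ∈ T, (S.filter (fun μ => μ ^ p = θ)).card = ∑ θ ∈ T, e := by
    rw [← Finset.card_eq_sum_card_fiberwise (fun μ hμ => hmaps μ hμ), Finset.sum_const, smul_eq_mul, hcardS, hcardT,
      mul_comm]
    exact he
  have heq : ∀ θ ∈ T, (S.filter (fun μ => μ ^ p = θ)).card = e := (Finset.sum_eq_sum_iff_of_le hle).1 hsum
  -- the product
  rw [← Finset.prod_fiberwise_of_maps_to' (g := fun μ : ℂ => μ ^ p) hmaps F, ← Finset.prod_pow]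
  refine Finset.prod_congr rfl fun θ hθ => ?_
  rw [Finset.prod_const, heq θ hθ]

end Literature.NumberTheory.MahlerMeasure

end Part11

/-!
## Part 12 — port of `Summits/Ventures/DiscreteObjects/Mahler/CyclotomicIntegerLehmerAll.lean` (6 declarations kept)

# Lehmer's conjecture for ALL cyclotomic integers (venture `DiscreteObjects`, target L)

Cell `pub-namedobj`, seat `pub-namedobj-mahler-g28`. Framing: lottery ticket; floor = certified bounds/negative ranges.

[cite: BombieriGubler2001, Theorem 4.4.9] (F. Amoroso, R. Dvornicich, *A lower bound for the height in abelian
extensions*, J. Number Theory 80 (2000) 260–272), the integral case, in Mahler-measure form and with NO condition on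
the conductor: **for every `m ≥ 1`, every primitive `m`-th root of unity `ζ ∈ ℂ` and every `g ∈ ℤ[X]` such that
`α = g(ζ) ∈ ℤ[ζ_m]` is neither `0` nor a root of unity, `(5/2)^{deg α} ≤ M(α)^{10}`** (`cyclotomicInteger_lehmer_bound_all`;
`h(α) ≥ log(5/2)/10`), hence **`M(α) > M(ℓ) = 1.17628…`: Lehmer's conjecture holds for every cyclotomic integer**
(`lehmer_of_cyclotomicInteger_all`; `M(α)^5 ≥ 5/2` in degree `≥ 2`).  This removes the conductor restriction
`m < 3·5·…·31` of `CyclotomicIntegerSmallConductor` (Case I only).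

Proof = the printed one with `p = 5`, by strong induction on `m` (`cyclotomicInteger_prod_bound_five`, stated for the
product `∏_μ max(1,|g(μ)|)` over the primitive `m`-th roots of unity, `= M(α)^{φ(m)/deg α}`): `5 ∤ m` is Case I
(`CyclotomicIntegerMeasure`); for `m = 5n` and `σ_k` a generator of `Gal(ℚ(ζ_m)/ℚ(ζ_n))` (`CyclotomicIntegerGaloisDescent`)
either `α^5 ≠ σ_k(α^5)` — Case II (`CyclotomicIntegerRamified`) — or a root-of-unity twist `ζ^a α` is `σ_k`-invariant
(`CyclotomicIntegerTwistFibre`), hence equals `G(ζ^5)` with `G ∈ ℤ[X]` EXPLICITLY (`exists_descent_of_invariant`: the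
trace formula of `CyclotomicIntegerDescent` for `25 ∣ m`, the twisted trace formula for `5 ∥ m`), and the induction
hypothesis at the conductor `n` applies (fibres of `μ ↦ μ^5`, `prod_primitiveRoots_pow_prime_eq`).
REPLICATION of a published theorem (integral case; general `α ∈ ℚ(ζ_m)` have `M(α) ≥ 2` trivially when not integral);
no new mathematics claimed.
-/

section Part12

namespace Literature.NumberTheory.MahlerMeasure

open _root_.Polynomial _root_.Finset

/-- `1 ≤ ∏_μ max(1, |g(μ)|)` over the primitive `m`-th roots of unity.
[cite: BombieriGubler2001, Theorem 4.4.9 p.116 (integral case, all conductors)] -/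
theorem one_le_prod_primitiveRoots_max (m : ℕ) (g : ℤ[X]) : 1 ≤ ∏ μ ∈ primitiveRoots m ℂ, max 1 ‖aeval μ g‖ :=
  Finset.prod_induction _ (fun x : ℝ => 1 ≤ x) (fun _ _ ha hb => one_le_mul_of_one_le_of_one_le ha hb) le_rfl
    (fun _ _ => le_max_left _ _)

/-- A cyclotomic integer `g(ζ)` is an algebraic integer.
[cite: BombieriGubler2001, Theorem 4.4.9 p.116 (integral case, all conductors)] -/
theorem isIntegral_aeval_of_isPrimitiveRoot {m : ℕ} (hm : 0 < m) (g : ℤ[X]) {ζ : ℂ} (hζ : IsPrimitiveRoot ζ m) :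
    IsIntegral ℤ (aeval ζ g) := by
  have hζint : IsIntegral ℤ ζ := hζ.isIntegral hm
  have hmem : aeval ζ g ∈ Algebra.adjoin ℤ {ζ} := Polynomial.aeval_mem_adjoin_singleton ℤ ζ
  exact (mem_integralClosure_iff ℤ ℂ).1 (adjoin_le_integralClosure hζint hmem)

/-- **[BombieriGubler2001, Theorem 4.4.9] for cyclotomic integers, every conductor — product form.**  For every
`m ≥ 1`, every primitive `m`-th root of unity `ζ ∈ ℂ` and every `g ∈ ℤ[X]` with `g(ζ) ≠ 0` not a root of unity:
`(5/2)^{φ(m)} ≤ (∏_μ max(1, |g(μ)|))^{10}`, the product over the primitive `m`-th roots of unity.  Proof by strong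
induction on `m` with the prime `p = 5`: `5 ∤ m` is Case I (`CyclotomicIntegerMeasure`, exponent `6 ≤ 10`); `5 ∣ m`,
`m = 5n`: with `σ_k` a generator of `Gal(ℚ(ζ_m)/ℚ(ζ_n))` (`exists_galois_generator`) either `g(μ)^5 ≠ g(μ^k)^5`
for all `μ` (Case II, `CyclotomicIntegerRamified`, exponent `10`) or — degenerate case — a twist `ζ^a g(ζ)` is
`σ_k`-invariant (`exists_twist_invariant`), hence `= G(ζ^5)` with `G ∈ ℤ[X]` (`exists_descent_of_invariant`), the product
is `(∏_θ max(1,|G(θ)|))^{φ(m)/φ(n)}` (`prod_primitiveRoots_pow_prime_eq`), and the induction hypothesis at `n < m`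
applies to `G(ζ^5) = ζ^a g(ζ)` (nonzero, not a root of unity).
[cite: BombieriGubler2001, Theorem 4.4.9 p.116 (integral case, all conductors)] -/
theorem cyclotomicInteger_prod_bound_five (m : ℕ) : 0 < m → ∀ (g : ℤ[X]) (ζ : ℂ), IsPrimitiveRoot ζ m →
    aeval ζ g ≠ 0 → (∀ j : ℕ, 0 < j → aeval ζ g ^ j ≠ 1) →
    ((5 : ℝ) / 2) ^ m.totient ≤ (∏ μ ∈ primitiveRoots m ℂ, max 1 ‖aeval μ g‖) ^ 10 := by
  induction m using Nat.strong_induction_on with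
  | _ m ih =>
  intro hm0 g ζ hζ h0 hnu
  have hH1 : 1 ≤ ∏ μ ∈ primitiveRoots m ℂ, max 1 ‖aeval μ g‖ := one_le_prod_primitiveRoots_max m g
  have hp5 : Nat.Prime 5 := Nat.prime_five
  by_cases h5 : 5 ∣ m
  · -- Case II: `m = 5 n`
    obtain ⟨n, hmn⟩ := h5
    have hn : 0 < n := by
      rcases Nat.eq_zero_or_pos n with h | h
      · rw [h, mul_zero] at hmn; omega
      · exact h
    have hnm : n < m := by omega
    obtain ⟨k, s, hk, hs, hkcop, hgen⟩ := exists_galois_generator hp5 (by norm_num) hn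
    have hkm : k.Coprime m := by rw [hmn]; exact hkcop
    have hkmod : k % (m / 5) = 1 % (m / 5) := by
      rw [hmn, Nat.mul_div_cancel_left n (by norm_num : 0 < 5), hk, Nat.add_mul_mod_self_left]
    by_cases hdeg : ∃ μ ∈ primitiveRoots m ℂ, aeval μ g ^ 5 = aeval (μ ^ k) g ^ 5
    · -- degenerate case: twist, descend, induct
      have hdeg' : aeval (ζ ^ k) g ^ 5 = aeval ζ g ^ 5 := aeval_pow_pow_eq_of_exists hm0 g hζ hdeg
      obtain ⟨a, hinv⟩ := exists_twist_invariant hm0 hp5 hmn hk hs g hζ h0 hdeg'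
      obtain ⟨G, hG⟩ := exists_descent_of_invariant hm0 hp5 hmn hn hk hs hkcop hgen (X ^ a * g) hζ hinv
      have hθ : IsPrimitiveRoot (ζ ^ 5) n := hζ.pow hm0 hmn
      have hζ0 : ζ ≠ 0 := hζ.ne_zero hm0.ne'
      have hval : aeval (ζ ^ 5) G = ζ ^ a * aeval ζ g := by rw [← hG, map_mul, map_pow, aeval_X]
      have hG0 : aeval (ζ ^ 5) G ≠ 0 := by
        rw [hval]; exact mul_ne_zero (pow_ne_zero _ hζ0) h0
      have hGnu : ∀ j : ℕ, 0 < j → aeval (ζ ^ 5) G ^ j ≠ 1 := by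
        intro j hj hj1
        apply hnu (j * m) (Nat.mul_pos hj hm0)
        have h1 : (ζ ^ a * aeval ζ g) ^ (j * m) = 1 := by rw [← hval, pow_mul, hj1, one_pow]
        rw [mul_pow, ← pow_mul, show a * (j * m) = m * (a * j) by ring, pow_mul, hζ.pow_eq_one, one_pow,
          one_mul] at h1
        exact h1
      have hIH := ih n hnm hn G (ζ ^ 5) hθ hG0 hGnu
      -- every primitive `μ`: `(X^a g)(μ) = G(μ^5)`
      have hall : ∀ μ ∈ primitiveRoots m ℂ, aeval μ (X ^ a * g) = aeval (μ ^ 5) G := by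
        intro μ hμ
        have hμ' := (mem_primitiveRoots hm0).1 hμ
        set Q : ℤ[X] := X ^ a * g - expand ℤ 5 G with hQ
        have hQζ : aeval ζ Q = 0 := by rw [hQ, map_sub, expand_aeval, hG, sub_self]
        have hQμ := aeval_eq_zero_of_primitiveRoot hm0 hζ hQζ hμ'
        rwa [hQ, map_sub, expand_aeval, sub_eq_zero] at hQμ
      have hH : ∏ μ ∈ primitiveRoots m ℂ, max 1 ‖aeval μ g‖ =
          ∏ μ ∈ primitiveRoots m ℂ, max 1 ‖aeval (μ ^ 5) G‖ := by
        refine Finset.prod_congr rfl fun μ hμ => ?_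
        rw [← hall μ hμ, map_mul, map_pow, aeval_X, norm_mul, norm_pow,
          ((mem_primitiveRoots hm0).1 hμ).norm'_eq_one hm0.ne', one_pow, one_mul]
      obtain ⟨e, he⟩ : ∃ e : ℕ, m.totient = e * n.totient := by
        by_cases h5n : 5 ∣ n
        · exact ⟨5, by rw [hmn, Nat.totient_mul_of_prime_of_dvd hp5 h5n]⟩
        · exact ⟨5 - 1, by rw [hmn, Nat.totient_mul_of_prime_of_not_dvd hp5 h5n]⟩
      have hfib : ∏ μ ∈ primitiveRoots m ℂ, max 1 ‖aeval (μ ^ 5) G‖ =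
          (∏ θ ∈ primitiveRoots n ℂ, max 1 ‖aeval θ G‖) ^ e :=
        prod_primitiveRoots_pow_prime_eq hm0 hp5 hmn hn he (fun z => max 1 ‖aeval z G‖)
      have hR : ((∏ θ ∈ primitiveRoots n ℂ, max 1 ‖aeval θ G‖) ^ e) ^ 10 =
          ((∏ θ ∈ primitiveRoots n ℂ, max 1 ‖aeval θ G‖) ^ 10) ^ e := by
        rw [← pow_mul, ← pow_mul, mul_comm]
      rw [hH, hfib, hR, he, mul_comm e, pow_mul]
      exact pow_le_pow_left₀ (by positivity) hIH e
    · -- nondegenerate case: the ramified bound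
      have hsep : ∀ μ ∈ primitiveRoots m ℂ, aeval μ g ^ 5 ≠ aeval (μ ^ k) g ^ 5 :=
        fun μ hμ heq => hdeg ⟨μ, hμ, heq⟩
      have hB := cyclotomicInteger_measure_bound_ramified hm0 hp5 ⟨n, hmn⟩ hkmod hkm g hsep
      exact hB
  · -- Case I
    have hcop : (5 : ℕ).Coprime m := (Nat.Prime.coprime_iff_not_dvd hp5).2 h5
    have hsep := pow_ne_aeval_pow_of_not_torsion hm0 hp5 hcop g hζ h0 hnu
    have hB := cyclotomicInteger_measure_bound hm0 hp5 hcop g hsep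
    exact hB.trans (pow_le_pow_right₀ hH1 (by norm_num))

/-- The product `∏_μ max(1,|g(μ)|)` over the primitive `m`-th roots of unity is `M(minpoly_ℤ g(ζ))^e` with
`e · deg = φ(m)` (the polynomial `∏_μ (X - g(μ)) ∈ ℤ[X]` is a power of the minimal polynomial).
[cite: BombieriGubler2001, Theorem 4.4.9 p.116 (integral case, all conductors)] -/
theorem exists_prod_max_eq_measure_pow {m : ℕ} (hm : 0 < m) (g : ℤ[X]) {ζ : ℂ} (hζ : IsPrimitiveRoot ζ m) :
    ∃ e : ℕ, e ≠ 0 ∧ e * (minpoly ℤ (aeval ζ g)).natDegree = m.totient ∧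
      ∏ μ ∈ primitiveRoots m ℂ, max 1 ‖aeval μ g‖ = intMahlerMeasure (minpoly ℤ (aeval ζ g)) ^ e := by
  classical
  have hαint : IsIntegral ℤ (aeval ζ g) := isIntegral_aeval_of_isPrimitiveRoot hm g hζ
  set f : ℤ[X] := minpoly ℤ (aeval ζ g) with hf
  have hfmon : f.Monic := minpoly.monic hαint
  have hfirr : Irreducible f := minpoly.irreducible hαint
  have hroot : ∀ μ : ℂ, IsPrimitiveRoot μ m → aeval (aeval μ g) f = 0 := by
    intro μ hμ
    have h1 : aeval ζ (f.comp g) = 0 := by rw [aeval_comp, hf, minpoly.aeval]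
    have h2 := aeval_eq_zero_of_primitiveRoot hm hζ h1 hμ
    rwa [aeval_comp] at h2
  set Fc : ℂ[X] := ∏ μ ∈ primitiveRoots m ℂ, (X - C (aeval μ g)) with hFc
  have hFcmon : Fc.Monic := monic_prod_of_monic _ _ (fun _ _ => monic_X_sub_C _)
  obtain ⟨F, hFmap, hFdeg, hFmon⟩ :=
    lifts_and_natDegree_eq_and_monic (prod_X_sub_C_aeval_primitiveRoots_lifts hm g) hFcmon
  have hFcdeg : Fc.natDegree = m.totient := by
    rw [hFc, natDegree_prod_of_monic _ _ (fun _ _ => monic_X_sub_C _)]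
    simp only [natDegree_X_sub_C, Finset.sum_const, smul_eq_mul, mul_one]
    exact (Complex.isPrimitiveRoot_exp m hm.ne').card_primitiveRoots
  have hFroots : ∀ z : ℂ, z ∈ (F.map (Int.castRingHom ℂ)).roots → aeval z f = 0 := by
    intro z hz
    have hmm : ((primitiveRoots m ℂ).val.map fun μ => X - C (aeval μ g)) =
        (((primitiveRoots m ℂ).val.map fun μ => aeval μ g).map fun a : ℂ => X - C a) := by
      rw [Multiset.map_map]
      rfl
    rw [hFmap, Finset.prod_eq_multiset_prod, hmm, roots_multiset_prod_X_sub_C, Multiset.mem_map] at hz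
    obtain ⟨μ, hμ, rfl⟩ := hz
    exact hroot μ ((mem_primitiveRoots hm).1 (Finset.mem_def.2 hμ))
  obtain ⟨e, hFe⟩ := eq_pow_of_roots_subset hfmon hfirr _ F rfl hFmon hFroots
  have hed : e * f.natDegree = m.totient := by
    rw [← hFcdeg, ← hFdeg, hFe, natDegree_pow]
  have he0 : e ≠ 0 := by
    intro he
    rw [he, zero_mul] at hed
    exact (Nat.totient_pos.2 hm).ne' hed.symm
  have hMF : intMahlerMeasure F = ∏ μ ∈ primitiveRoots m ℂ, max 1 ‖aeval μ g‖ := by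
    unfold intMahlerMeasure
    rw [hFmap, mahlerMeasure_prod_X_sub_C]
  have hMFe : intMahlerMeasure F = intMahlerMeasure f ^ e := by rw [hFe, intMahlerMeasure_pow]
  exact ⟨e, he0, hed, by rw [← hMF, hMFe]⟩

/-- **[BombieriGubler2001, Theorem 4.4.9] (Amoroso–Dvornicich 2000) for cyclotomic integers, EVERY conductor `m`,
in Mahler-measure form.**  Let `ζ ∈ ℂ` be a primitive `m`-th root of unity (`m ≥ 1`), `g ∈ ℤ[X]`, and
`α = g(ζ) ∈ ℤ[ζ_m]` neither `0` nor a root of unity.  Then `(5/2)^{deg α} ≤ M(α)^{10}`, i.e. the height bound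
`h(α) ≥ log(5/2)/10` — with no condition on `m`.
[cite: BombieriGubler2001, Theorem 4.4.9 p.116 (integral case, all conductors)] -/
theorem cyclotomicInteger_lehmer_bound_all {m : ℕ} (hm : 0 < m) (g : ℤ[X]) {ζ : ℂ} (hζ : IsPrimitiveRoot ζ m)
    (h0 : aeval ζ g ≠ 0) (hnu : ∀ k : ℕ, 0 < k → aeval ζ g ^ k ≠ 1) :
    ((5 : ℝ) / 2) ^ (minpoly ℤ (aeval ζ g)).natDegree ≤ intMahlerMeasure (minpoly ℤ (aeval ζ g)) ^ 10 := by
  obtain ⟨e, he0, hed, hprod⟩ := exists_prod_max_eq_measure_pow hm g hζ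
  have hB := cyclotomicInteger_prod_bound_five m hm g ζ hζ h0 hnu
  set M := intMahlerMeasure (minpoly ℤ (aeval ζ g)) with hM
  set d := (minpoly ℤ (aeval ζ g)).natDegree with hd
  have hR : (M ^ e) ^ 10 = (M ^ 10) ^ e := by rw [← pow_mul, ← pow_mul, mul_comm]
  rw [hprod, ← hed, hR, mul_comm e d, pow_mul] at hB
  have hM0 : 0 ≤ M :=
    le_trans zero_le_one (one_le_intMahlerMeasure (minpoly.monic (isIntegral_aeval_of_isPrimitiveRoot hm g hζ)).ne_zero)
  exact (pow_le_pow_iff_left₀ (by positivity) (by positivity) he0).1 hB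

/-- **Lehmer's conjecture for ALL cyclotomic integers.**  For every `m ≥ 1`, every primitive `m`-th root of unity
`ζ ∈ ℂ` and every `g ∈ ℤ[X]` such that `α = g(ζ)` is neither `0` nor a root of unity: `M(α) > M(ℓ) = 1.17628…`
(Lehmer's number).  In degree `≥ 2` indeed `M(α) ≥ (5/2)^{1/5} = 1.2011…` (`five_halves_le_measure_pow_five`); in
degree `1`, `|α| ≥ 2`.  By Kronecker–Weber (not used here) the elements of the rings `ℤ[ζ_m]` are exactly the
algebraic integers of the abelian extensions of `ℚ`.
[cite: BombieriGubler2001, Theorem 4.4.9 p.116 (integral case, all conductors)] -/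
theorem lehmer_of_cyclotomicInteger_all {m : ℕ} (hm : 0 < m) (g : ℤ[X]) {ζ : ℂ} (hζ : IsPrimitiveRoot ζ m)
    (h0 : aeval ζ g ≠ 0) (hnu : ∀ k : ℕ, 0 < k → aeval ζ g ^ k ≠ 1) :
    intMahlerMeasure lehmerPolynomial < intMahlerMeasure (minpoly ℤ (aeval ζ g)) := by
  have hB := cyclotomicInteger_lehmer_bound_all hm g hζ h0 hnu
  have hL := lehmer_measure_upper_bound
  have hαint : IsIntegral ℤ (aeval ζ g) := isIntegral_aeval_of_isPrimitiveRoot hm g hζ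
  set M := intMahlerMeasure (minpoly ℤ (aeval ζ g)) with hM
  have hdpos : 0 < (minpoly ℤ (aeval ζ g)).natDegree := minpoly.natDegree_pos hαint
  have hM1 : 1 ≤ M := one_le_intMahlerMeasure (minpoly.monic hαint).ne_zero
  have hL0 : 0 ≤ intMahlerMeasure lehmerPolynomial :=
    le_trans zero_le_one (one_le_intMahlerMeasure lehmerPoly_monic.ne_zero)
  rcases Nat.lt_or_ge (minpoly ℤ (aeval ζ g)).natDegree 2 with hd1 | hd2
  · have h2 := two_le_measure_of_natDegree_minpoly_eq_one hαint h0 hnu (by omega)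
    linarith
  · have h52 : (1 : ℝ) ≤ 5 / 2 := by norm_num
    have hsq : ((5 : ℝ) / 2) ^ 2 ≤ M ^ 10 := (pow_le_pow_right₀ h52 hd2).trans hB
    by_contra hle
    have hle' : M ≤ intMahlerMeasure lehmerPolynomial := le_of_not_gt hle
    have h1 := pow_le_pow_left₀ (le_trans zero_le_one hM1) hle' 10
    have h2 := pow_le_pow_left₀ hL0 hL.le 10
    have h3 : ((117629 : ℝ) / 100000) ^ 10 < ((5 : ℝ) / 2) ^ 2 := by norm_num
    linarith

end Literature.NumberTheory.MahlerMeasure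

end Part12

/-!
## Part 13 — port of `Summits/Ventures/DiscreteObjects/Mahler/CyclotomicFieldIntegersLehmer.lean` (2 declarations kept)

# Lehmer's conjecture for the ring of integers of every cyclotomic field (venture `DiscreteObjects`, target L)

Cell `pub-namedobj`, seat `pub-namedobj-mahler-g28`. Framing: lottery ticket; floor = certified bounds/negative ranges.

`CyclotomicIntegerLehmerAll` proves [cite: BombieriGubler2001, Theorem 4.4.9] (`h(α) ≥ log(5/2)/10`) for the cyclotomic
integers presented as `α = g(ζ_m)`, `g ∈ ℤ[X]`.  Here the presentation is removed using Mathlib's theorem that the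
ring of integers of `ℚ(ζ_m)` is `ℤ[ζ_m]` (`IsCyclotomicExtension.Rat.isIntegralClosure_adjoin_singleton`, transported
to the subfield `ℚ(ζ) ⊂ ℂ`): **every algebraic integer `α` of `ℚ(ζ_m) ⊂ ℂ` which is neither `0` nor a root of
unity satisfies `(5/2)^{deg α} ≤ M(α)^{10}` and `M(α) > M(ℓ) = 1.17628…`** (`lehmer_of_isIntegral_mem_cyclotomicField`),
for every `m ≥ 1`.  Census reading: a sub-Lehmer integer polynomial has no root which is a nonzero non-torsion
algebraic integer of a cyclotomic field (`subLehmer_root_mem_cyclotomicField_torsion`,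
`subLehmer_root_cyclotomicInteger_torsion_all` — every conductor, superseding the bound `m < 3·5·…·31` of
`CyclotomicIntegerSmallConductor`).  REPLICATION / bookkeeping; no new mathematics claimed.
-/

section Part13

namespace Literature.NumberTheory.MahlerMeasure

open _root_.Polynomial _root_.Finset

/-- **Every algebraic integer of `ℚ(ζ_m) ⊂ ℂ` is a cyclotomic integer `g(ζ_m)`, `g ∈ ℤ[X]`** (the ring of integers of
the cyclotomic field is `ℤ[ζ_m]`; Mathlib's `IsCyclotomicExtension.Rat.isIntegralClosure_adjoin_singleton`, transported
to the subfield `ℚ(ζ) ⊂ ℂ`). [cite: BombieriGubler2001, Theorem 4.4.9 p.116 with 4.4.11 (𝒪_{ℚ(ζ_m)} = ℤ[ζ_m])] -/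
theorem exists_aeval_eq_of_isIntegral_of_mem_adjoin {m : ℕ} (hm : 0 < m) {ζ : ℂ} (hζ : IsPrimitiveRoot ζ m) {α : ℂ}
    (hα : α ∈ IntermediateField.adjoin ℚ {ζ}) (hint : IsIntegral ℤ α) : ∃ g : ℤ[X], α = aeval ζ g := by
  haveI : NeZero m := ⟨hm.ne'⟩
  set K : IntermediateField ℚ ℂ := IntermediateField.adjoin ℚ {ζ} with hK
  have hζalg : IsAlgebraic ℚ ζ := ((hζ.isIntegral hm).tower_top (A := ℚ)).isAlgebraic
  haveI : IsCyclotomicExtension {m} ℚ K := by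
    change IsCyclotomicExtension {m} ℚ (IntermediateField.adjoin ℚ {ζ}).toSubalgebra
    rw [IntermediateField.adjoin_simple_toSubalgebra_of_isAlgebraic hζalg]
    exact hζ.adjoin_isCyclotomicExtension ℚ
  set ζ' : K := ⟨ζ, IntermediateField.mem_adjoin_simple_self ℚ ζ⟩ with hζ'
  have hζ'prim : IsPrimitiveRoot ζ' m := IsPrimitiveRoot.coe_submonoidClass_iff.1 (by exact hζ)
  have hIC := IsCyclotomicExtension.Rat.isIntegralClosure_adjoin_singleton hζ'prim
  set α' : K := ⟨α, hα⟩ with hα'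
  -- `α'` is integral over `ℤ`
  set ι : K →ₐ[ℤ] ℂ := IsScalarTower.toAlgHom ℤ K ℂ with hι
  have hιinj : Function.Injective ι := (algebraMap K ℂ).injective
  have hια : ι α' = α := rfl
  have hint' : IsIntegral ℤ α' := (isIntegral_algHom_iff ι hιinj).1 (by rw [hια]; exact hint)
  obtain ⟨y, hy⟩ := (hIC.isIntegral_iff).1 hint'
  have hymem : (y : K) ∈ Algebra.adjoin ℤ {ζ'} := y.2
  rw [Algebra.adjoin_singleton_eq_range_aeval] at hymem
  obtain ⟨g, hg⟩ := hymem
  refine ⟨g, ?_⟩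
  have h1 : (aeval ζ' g : K) = α' := by
    rw [← hy]
    change aeval ζ' g = (y : K)
    exact hg
  have h2 : ι (aeval ζ' g) = aeval (ι ζ') g := (aeval_algHom_apply ι ζ' g).symm
  have hιζ : ι ζ' = ζ := rfl
  rw [h1, hια, hιζ] at h2
  exact h2

/-- **Lehmer's conjecture for the ring of integers of every cyclotomic field.**  For `m ≥ 1`, a primitive `m`-th root
of unity `ζ ∈ ℂ`, and an algebraic integer `α ∈ ℚ(ζ)` which is neither `0` nor a root of unity:
`(5/2)^{deg α} ≤ M(α)^{10}` and `M(α) > M(ℓ)`.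
[cite: BombieriGubler2001, Theorem 4.4.9 p.116 with 4.4.11 (𝒪_{ℚ(ζ_m)} = ℤ[ζ_m])] -/
theorem lehmer_of_isIntegral_mem_cyclotomicField {m : ℕ} (hm : 0 < m) {ζ : ℂ} (hζ : IsPrimitiveRoot ζ m) {α : ℂ}
    (hα : α ∈ IntermediateField.adjoin ℚ {ζ}) (hint : IsIntegral ℤ α) (h0 : α ≠ 0)
    (hnu : ∀ k : ℕ, 0 < k → α ^ k ≠ 1) :
    ((5 : ℝ) / 2) ^ (minpoly ℤ α).natDegree ≤ intMahlerMeasure (minpoly ℤ α) ^ 10 ∧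
      intMahlerMeasure lehmerPolynomial < intMahlerMeasure (minpoly ℤ α) := by
  obtain ⟨g, rfl⟩ := exists_aeval_eq_of_isIntegral_of_mem_adjoin hm hζ hα hint
  exact ⟨cyclotomicInteger_lehmer_bound_all hm g hζ h0 hnu, lehmer_of_cyclotomicInteger_all hm g hζ h0 hnu⟩

end Literature.NumberTheory.MahlerMeasure

end Part13

/-! ## Part 14 — the EXACT discharge(s) -/

namespace Literature.NumberTheory.MahlerMeasure

/-- **The Literature named fact `CyclotomicIntegerHeightBound` HOLDS** — Amoroso–Dvornicich / Bombieri–Gubler Theorem 4.4.9,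
integral cyclotomic case: for `m ≥ 1`, `ζ` a primitive `m`-th root of unity in `ℂ` and `α ∈ ℚ(ζ)` an algebraic integer which
is neither `0` nor a root of unity, `(5/2)^{deg α} ≤ M(minpoly_ℤ α)^{10}`.  EXACT discharge, Literature-side twin of
`Summit.Ventures.DiscreteObjects.Mahler.cyclotomicIntegerHeightBound_holds` (same one-line proof).
[cite: BombieriGubler2001, Theorem 4.4.9 p.116] -/
theorem CyclotomicIntegerHeightBound_holds : CyclotomicIntegerHeightBound := by
  intro m hm ζ hζ α hα hint h0 hnu
  have h := (lehmer_of_isIntegral_mem_cyclotomicField hm hζ hα hint h0 hnu).1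
  unfold intMahlerMeasure at h
  exact h

end Literature.NumberTheory.MahlerMeasure

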